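import Literature.Combinatorics.Optimization.PsdMinimalPolytopes
import HarnessLib

/-!
# Adding an inequality costs one, and all convex pentagons have psd rank exactly four
# (Gouveia–Robinson–Thomas, *Worst-case results for psd rank*, Lemmas 3.1, 3.3, Example 3.2) — PROVED

Source. J. Gouveia, R. Z. Robinson, R. R. Thomas, *Worst-case results for positive semidefinite rank*,
Math. Program. 153 (2015) 201–212 = arXiv:1305.4600 [GouveiaRobinsonThomas2015] (held text
`paper:arxiv-1305.4600`, §3 "An upper bound on psd rank of polygons" on chunks p06–p07). The survey
H. Fawzi, J. Gouveia, P. A. Parrilo, R. Z. Robinson, R. R. Thomas, *Positive semidefinite rank*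
[FawziEtAl2015] cites this paper ([gouveia2013worst]) for its Theorem 3.3 (= Prop. 3.6 here, the tree's
`FawziEtAl2015_thm33_holds`) and in §9.4; the companion DCG paper [GouveiaRobinsonThomas2013] (the tree's
`PsdMinimalPolytopes.lean`: triangles and quadrilaterals have psd rank three, every `m`-gon with
`m ≥ 5` has psd rank `≥ 4`) leaves the exact value for pentagons open; it is settled here.

Contents (everything in the first four groups is PROVED; the last group records the paper's
remaining §§2–3 results as cited named facts):

* **Lemma 3.1** (p06, verbatim): "Let `P` be a polytope with `rank_psd(P) = k`, and let `P̃` be a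
  polytope obtained from `P` by adding either a single inequality to the facet description of `P` or a
  single point to the vertex description of `P`. Then `rank_psd(P̃) ≤ k + 1`."
  - matrix forms (for slack matrices the two halves are transposes of each other): appending one
    nonnegative row / column to a matrix raises `rank_psd` by at most one —
    `hasPsdFactorization_succ_of_castSucc`, `hasPsdFactorization_succ_of_castSucc_col`;
  - lift form of the first half, with the printed bordered pencil `G̃_i = G_i ⊕ ã_i`:
    `HasPsdLift.inter_halfspace` (`C = π(S^k_+ ∩ L)` ⇒ `C ∩ {φ ≤ b} = π'(S^{k+1}_+ ∩ L')`, for ANY set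
    `C` with a psd lift, `L' = {M ⊕ (b − φ(πM)) : M ∈ L}`), iterated: `HasPsdLift.inter_halfspaces`
    (`r` inequalities cost `≤ r`). The second half in lift form ("adding a point", via polarity in
    print) is not typed as such; its slack-matrix content is the row form above.
* **Lemma 3.3** (p07: "`P = π(Q)` … `rank_psd(P) ≤ rank_psd(Q)`"): `HasPsdLift.image`.
* **Example 3.2** (p06, verbatim): "By [GRT2012], all triangles and quadrilaterals have psd rank three
  and any polygon with at least five sides has psd rank at least four. Since a pentagon can be obtained
  by adding an inequality to the facet description of a quadrilateral, Lemma 3.1 implies that all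
  pentagons have psd rank exactly four." `GouveiaRobinsonThomas2015_ex32`: for every convex pentagon
  (vertex list `x : Fin 5 → ℝ²` in counterclockwise strictly convex position, `IsConvexPolygon x` of
  `PsdMinimalPolytopes.lean`) the vertex/edge slack matrix has a psd factorization of size `4` and none
  of size `3`; lift form `GouveiaRobinsonThomas2015_ex32_lift` (`conv{x_i} = π(S^4_+ ∩ L)` and no psd
  lift of size `< 4`, through FGPRT Thm. 3.3 `IsConvexPolygon.hasPsdLift_iff`).
* (appended) **Lemma 3.1 for ALL convex polygons, dual form**: dropping a vertex of a convex
  `(m+1)`-gon leaves a convex `m`-gon (`isConvexPolygon_dropVertex`, `m ≥ 3`) and costs at most one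
  in psd rank (`IsConvexPolygon.hasPsdFactorization_succ_of_dropVertex`, the multipliers by Cramer's
  rule, uniformly in the rows); hence `IsConvexPolygon.hasPsdFactorization_sub_one`: every convex
  `m`-gon, `m ≥ 4`, has a psd factorization of size `m − 1` (the bound obtained from quadrilaterals by
  Lemma 3.1 alone; p07 improves it by one through Thm. 3.4). Tool: `IsConvexPolygon.cross2_pos` — three
  vertices of a convex polygon in cyclic order are positively oriented (all `x_i − x_a` lie left of the
  edge at `x_a` and consecutive ones turn left; transitivity by the Grassmann–Plücker relation).
* (appended) **Typed as named facts, not proved here**: Theorem 2.1 (`GouveiaRobinsonThomas2015_thm21`: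
  a generic — algebraically independent vertex coordinates — full-dimensional polytope with `v`
  vertices in `ℝⁿ` has no psd lift of size `< (nv)^{1/4}`; printed proof by SDP duality, Tarski–Seidenberg and transcendence
  degree), Theorem 3.4 (`GouveiaRobinsonThomas2015_thm34`: every convex hexagon has a psd
  factorization of size `4`; printed proof through the biplanar octahedra of GRT 2013 Thm. 4.8 — this
  fact is now PROVED in the last section, `GouveiaRobinsonThomas2015_thm34_holds`), Theorem
  3.7 (`GouveiaRobinsonThomas2015_thm37`: a nonnegative rank-three `p × q` matrix has `rank_psd ≤
  4⌈min{p,q}/6⌉`, "in particular the psd rank of a `v`-gon is at most `4⌈v/6⌉`" — the polygon clause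
  is now PROVED in the last section, `GouveiaRobinsonThomas2015_thm37_polygon`, and the general matrix
  form is DISCHARGED downstream, `GouveiaRobinsonThomas2015_thm37_holds` in `RankThreePsdRank.lean`,
  through the planar convex-hull structure theorem of `PlanarConvexHullPolygon.lean`), with the proved companions
  `GouveiaRobinsonThomas2015_thm34.exact` (given the fact: hexagons have psd rank EXACTLY `4`),
  `GouveiaRobinsonThomas2015_thm34.hasPsdFactorization_sub_two` (given the fact: `m`-gons, `m ≥ 6`, have
  `rank_psd ≤ m − 2`, the p07 remark on `7`- and `8`-gons) and `GouveiaRobinsonThomas2015_thm37_polygon_of_le_five`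
  (the clause of Thm. 3.7 for `m ≤ 5`, unconditionally).

* (appended) **Theorem 3.4 PROVED** (p07, verbatim: "Every hexagon has psd rank exactly four"):
  `IsConvexPolygon.hasPsdFactorization_four_hexagon` (every convex hexagon's slack matrix has an
  `S^4_+`-factorization — explicit: rank-one row factors, rank-two column factors, entries square roots
  of slacks), the discharge `GouveiaRobinsonThomas2015_thm34_holds`, `IsConvexPolygon.psdRank_hexagon`
  (exactly four), `GouveiaRobinsonThomas2015_thm34_lift` (lift form), and the now unconditional
  consequences `IsConvexPolygon.hasPsdFactorization_sub_two` (`m`-gons, `m ≥ 6`: size `m − 2`) and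
  `IsConvexPolygon.psdRank_heptagon_bounds` ("all `7`-gons have psd rank either four or five").
* (appended) **Theorem 3.7, polygon clause PROVED** (p07, verbatim: "In particular, the psd rank of
  a `v`-gon is at most `4⌈v/6⌉`"): `IsConvexPolygon.hasPsdFactorization_four_mul_ceil_div_six` /
  `GouveiaRobinsonThomas2015_thm37_polygon` (+ `_lift`, `IsConvexPolygon.psdRank_bounds`), through
  `sum_polygonSlack_row` (row sums = twice the area), `IsConvexPolygon.exists_edgeCoeffs_of_valid`
  (valid inequalities are nonnegative combinations of edge inequalities on the vertices),
  `IsConvexPolygon.hasPsdFactorization_of_valid` (Prop. 3.6 at matrix level: generalized slack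
  matrices of a polygon against valid functionals cost no more than its slack matrix), the polar
  polygon about the vertex centroid (`polarVertex`, `polygonSlack_eq_slackCenter_mul`,
  `slackCenter_mul_polygonSlack_polarVertex`, `isConvexPolygon_polarVertex`), consecutive
  sub-polygons (`IsConvexPolygon.takeFirst`, `IsConvexPolygon.hexagonAt`) and the block step
  `IsConvexPolygon.hasPsdFactorization_four_block`.
* (appended) **Polarity preserves psd rank for polygons** (GRT 2013 p12):
  `IsConvexPolygon.hasPsdFactorization_polarVertex_iff`; and the p07 sentence "a `6 × q` nonnegative
  matrix of rank three is the generalized slack matrix of a hexagon inside a `q`-gon and so has psd rank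
  at most four" for row points in convex position: `IsConvexPolygon.hasPsdFactorization_four_of_valid`.

Proof of Example 3.2 (a recorded deviation: the DUAL form of the printed sentence, at the level of
slack matrices, so that no intersection point of extended edges and no boundedness argument is
needed). Drop the VERTEX `x₄`: the four remaining vertices are a convex quadrilateral `Q`
(`isConvexPolygon_dropLast`; its new edge `[x₃, x₀]` has slacks `S(3,0)`, `S(0,2)` at `x₁, x₂` —
`polygonSlack_dropLast`, pure re-indexing), so `S_Q` has an `S^3_+`-factorization `(A_k, B_c)` (GRT 2013
Thm. 4.7, `IsConvexPolygon.hasPsdFactorization_three_of_eq_four`). The two pentagon edges at `x₄` are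
valid on `Q` and tight at the vertices `x₃`, `x₀` of `Q`; on the four vertices of `Q` their slacks are
the nonnegative combinations `ℓ₃ = (S(0,3)/S(0,2)) ℓ₂ + (S(2,3)/S(0,2)) ℓ_{[x₃,x₀]}` and
`ℓ₄ = (S(3,4)/S(3,0)) ℓ₀ + (S(1,4)/S(3,0)) ℓ_{[x₃,x₀]}` (three affine functions vanishing at a common
point; the one nontrivial evaluation each is a polynomial identity in the coordinates), which gives psd
factors for these two columns on the rows `x₀,…,x₃`; the row of `x₄` is then appended by Lemma 3.1
(`hasPsdFactorization_succ_of_castSucc`). The lower bound `4` is GRT 2013 Thm. 4.7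
(`IsConvexPolygon.not_hasPsdFactorization_three`).

NOT here (beyond the typed facts): PROOF of Theorem 2.1; the proof of the general matrix form of
Theorem 3.7 (six arbitrary points need the facial structure of their convex hull — supplied by
`PlanarConvexHullPolygon.lean`; the discharge `GouveiaRobinsonThomas2015_thm37_holds` is in
`RankThreePsdRank.lean`; the polygon clause is proved here); Definition 3.5 /
Proposition 3.6 (= FGPRT Def. 3.1 / Thm. 3.3, in `PsdLiftSlackMatrix.lean`); §4 (deciding
`rank_psd = k` for `rank = C(k+1,2)` by quantifier elimination); the "adding a point" half of Lemma 3.1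
as a statement on lifts of general convex sets (via polarity in print).
-/

noncomputable section

open Matrix Finset
open scoped MatrixOrder

namespace Literature.Combinatorics.Optimization

/-! ### Lemma 3.1 in matrix form: one more row or column costs at most one -/

/-- **GRT Lemma 3.1, matrix form (rows)** (p06: "let `P̃` be a polytope obtained from `P` by adding …
a single point to the vertex description of `P`. Then `rank_psd(P̃) ≤ k + 1`"; for slack matrices:
appending one nonnegative ROW raises the psd rank by at most one — factors `A_i ⊕ 0`, `0 ⊕ 1` and
`B_j ⊕ (M_{last,j})`). [cite: GouveiaRobinsonThomas2015, Lemma 3.1 (p06)] -/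
theorem hasPsdFactorization_succ_of_castSucc {n : ℕ} {κ : Type*} {M : Fin (n + 1) → κ → ℝ} {k : ℕ}
    (h : HasPsdFactorization (fun i j => M (Fin.castSucc i) j) k) (hlast : ∀ j, 0 ≤ M (Fin.last n) j) :
    HasPsdFactorization M (k + 1) := by
  obtain ⟨A, B, hA, hB, hM⟩ := h
  -- `M = M¹ + M²`: `M¹` = `M` with the last row zeroed, `M²` = the last row alone
  let M₁ : Fin (n + 1) → κ → ℝ := fun i j => Fin.lastCases 0 (fun i' => M (Fin.castSucc i') j) i
  let M₂ : Fin (n + 1) → κ → ℝ := fun i j => Fin.lastCases (M (Fin.last n) j) (fun _ => 0) i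
  have h₁ : HasPsdFactorization M₁ k := by
    refine ⟨fun i => Fin.lastCases 0 (fun i' => A i') i, B, fun i => ?_, hB, fun i j => ?_⟩
    · induction i using Fin.lastCases with
      | last => simpa using PosSemidef.zero
      | cast i' => simpa using hA i'
    · induction i using Fin.lastCases with
      | last => simp [M₁]
      | cast i' => simpa [M₁] using hM i' j
  have h₂ : HasPsdFactorization M₂ 1 := by
    refine ⟨fun i => Fin.lastCases 1 (fun _ => 0) i, fun j => M (Fin.last n) j • (1 : Matrix (Fin 1) (Fin 1) ℝ),
      fun i => ?_, fun j => PosSemidef.one.smul (hlast j), fun i j => ?_⟩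
    · induction i using Fin.lastCases with
      | last => simpa using PosSemidef.one
      | cast i' => simpa using PosSemidef.zero
    · induction i using Fin.lastCases with
      | last => simp [M₂]
      | cast i' => simp [M₂]
  have hsum : (fun i j => M₁ i j + M₂ i j) = M := by
    funext i j
    induction i using Fin.lastCases with
    | last => simp [M₁, M₂]
    | cast i' => simp [M₁, M₂]
  simpa [hsum] using h₁.add h₂

/-- **GRT Lemma 3.1, matrix form (columns)** (p06: "adding a single inequality to the facet description
… `rank_psd(P̃) ≤ k + 1`"): appending one nonnegative COLUMN raises the psd rank by at most one.
[cite: GouveiaRobinsonThomas2015, Lemma 3.1 (p06)] -/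
theorem hasPsdFactorization_succ_of_castSucc_col {n : ℕ} {ι : Type*} {M : ι → Fin (n + 1) → ℝ} {k : ℕ}
    (h : HasPsdFactorization (fun i j => M i (Fin.castSucc j)) k) (hlast : ∀ i, 0 ≤ M i (Fin.last n)) :
    HasPsdFactorization M (k + 1) :=
  (hasPsdFactorization_succ_of_castSucc (M := fun j i => M i j) h.transpose hlast).transpose

/-! ### Lemma 3.3 and Lemma 3.1 for psd lifts -/

section Lifts

open Literature.Analysis.Convex (selMatrix padMatrix selMatrix_transpose_mul_padMatrix_add_mul
  posSemidef_padMatrix_add_iff)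

variable {E F : Type*} [AddCommGroup E] [Module ℝ E] [AddCommGroup F] [Module ℝ F]

/-- **GRT Lemma 3.3** (p07, verbatim): "Let `P` be a polytope and suppose there exists a polyhedron `Q`
and a linear map `π` such that `P = π(Q)`. Then `rank_psd(P) ≤ rank_psd(Q)`" — in lift form: a linear
image of a set with a psd lift of size `k` has a psd lift of size `k` (compose the projections).
[cite: GouveiaRobinsonThomas2015, Lemma 3.3 (p07)] -/
theorem HasPsdLift.image {C : Set E} {k : ℕ} (h : HasPsdLift C k) (f : E →ₗ[ℝ] F) :
    HasPsdLift (f '' C) k := by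
  obtain ⟨L, π, rfl⟩ := h
  exact ⟨L, f.comp π, by rw [Set.image_image]; rfl⟩

/-- A `1 × 1` real matrix `r • 1` is psd iff `r ≥ 0`. [folklore] -/
private theorem posSemidef_smul_one_fin_one_iff {r : ℝ} :
    (r • (1 : Matrix (Fin 1) (Fin 1) ℝ)).PosSemidef ↔ 0 ≤ r := by
  refine ⟨fun h => ?_, fun h => PosSemidef.one.smul h⟩
  have := h.dotProduct_mulVec_nonneg (Pi.single 0 1)
  simpa [Matrix.mulVec, dotProduct] using this

/-- **GRT Lemma 3.1, first half** (p06, verbatim): "Let `P` be a polytope with `rank_psd(P) = k`, and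
let `P̃` be a polytope obtained from `P` by adding … a single inequality to the facet description of
`P` … Then `rank_psd(P̃) ≤ k + 1`." Printed proof: border the linear pencil by the `1 × 1` block
`a_0 + a_1 x_1 + … + a_n x_n`. Typed for any set with a psd lift: `C = π(S^k_+ ∩ L)` gives
`C ∩ {x : φ(x) ≤ b} = π'(S^{k+1}_+ ∩ L')` with `L' = {M ⊕ (b − φ(π M)) : M ∈ L}`.
[cite: GouveiaRobinsonThomas2015, Lemma 3.1 (p06)] -/
theorem HasPsdLift.inter_halfspace {C : Set E} {k : ℕ} (h : HasPsdLift C k) (φ : E →ₗ[ℝ] ℝ) (b : ℝ) :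
    HasPsdLift (C ∩ {x | φ x ≤ b}) (k + 1) := by
  classical
  obtain ⟨L, π, rfl⟩ := h
  -- the two blocks of `S^{k+1}`: `e` = the first `k` indices, `f` = the last one
  let e : Fin k → Fin (k + 1) := Fin.castSucc
  let f : Fin 1 → Fin (k + 1) := fun _ => Fin.last k
  have he : Function.Injective e := Fin.castSucc_injective k
  have hf : Function.Injective f := fun a b _ => Subsingleton.elim a b
  have hef : ∀ a c, e a ≠ f c := fun a _ => (Fin.castSucc_lt_last a).ne
  let one1 : Matrix (Fin 1) (Fin 1) ℝ := 1
  -- the bordering map `Φ(M) = M ⊕ (b − φ(π M))`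
  let Φ : Matrix (Fin k) (Fin k) ℝ → Matrix (Fin (k + 1)) (Fin (k + 1)) ℝ :=
    fun M => padMatrix e M + padMatrix f ((b - φ (π M)) • one1)
  have hΦ : ∀ M, Φ M = padMatrix e M + (b - φ (π M)) • padMatrix f one1 := fun M => by
    simp only [Φ, map_smul]
  let L' : AffineSubspace ℝ (Matrix (Fin (k + 1)) (Fin (k + 1)) ℝ) :=
    { carrier := {M' | ∃ M ∈ L, Φ M = M'}
      smul_vsub_vadd_mem' := by
        rintro c _ _ _ ⟨M₁, h₁, rfl⟩ ⟨M₂, h₂, rfl⟩ ⟨M₃, h₃, rfl⟩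
        refine ⟨c • (M₁ -ᵥ M₂) +ᵥ M₃, L.smul_vsub_vadd_mem c h₁ h₂ h₃, ?_⟩
        simp only [hΦ, vsub_eq_sub, vadd_eq_add, map_add, map_smul, map_sub, smul_eq_mul]
        module }
  -- reading off the top-left block
  let tl : Matrix (Fin (k + 1)) (Fin (k + 1)) ℝ →ₗ[ℝ] Matrix (Fin k) (Fin k) ℝ :=
    { toFun := fun N => (selMatrix e)ᵀ * N * selMatrix e
      map_add' := fun N N' => by rw [Matrix.mul_add, Matrix.add_mul]
      map_smul' := fun c N => by rw [Matrix.mul_smul, Matrix.smul_mul, RingHom.id_apply] }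
  have htl : ∀ M, tl (Φ M) = M := fun M => selMatrix_transpose_mul_padMatrix_add_mul he hef M _
  have hpsd : ∀ M, (Φ M).PosSemidef ↔ M.PosSemidef ∧ φ (π M) ≤ b := fun M => by
    rw [show Φ M = padMatrix e M + padMatrix f ((b - φ (π M)) • one1) from rfl,
      posSemidef_padMatrix_add_iff he hf hef, posSemidef_smul_one_fin_one_iff, sub_nonneg]
  refine ⟨L', π.comp tl, Set.ext fun y => ⟨?_, ?_⟩⟩
  · rintro ⟨⟨M, ⟨hM, hML⟩, rfl⟩, hyb⟩
    refine ⟨Φ M, ⟨(hpsd M).mpr ⟨hM, hyb⟩, M, hML, rfl⟩, ?_⟩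
    simp [htl]
  · rintro ⟨M', ⟨hM', M, hML, rfl⟩, rfl⟩
    have h2 := (hpsd M).mp hM'
    refine ⟨⟨M, ⟨h2.1, hML⟩, by simp [htl]⟩, ?_⟩
    simpa [htl] using h2.2

/-- Iterating Lemma 3.1: `r` more inequalities cost at most `r` (e.g. "the trivial upper bound of six"
for octagons from quadrilaterals, p07). [cite: GouveiaRobinsonThomas2015, Lemma 3.1 (p06) and §3 (p07)] -/
theorem HasPsdLift.inter_halfspaces {C : Set E} {k r : ℕ} (h : HasPsdLift C k)
    (φ : Fin r → (E →ₗ[ℝ] ℝ)) (b : Fin r → ℝ) :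
    HasPsdLift (C ∩ {x | ∀ t, φ t x ≤ b t}) (k + r) := by
  induction r with
  | zero => simpa using h
  | succ r ih =>
    have h' := (ih (fun t => φ (Fin.castSucc t)) (fun t => b (Fin.castSucc t))).inter_halfspace
      (φ (Fin.last r)) (b (Fin.last r))
    have hset : C ∩ {x | ∀ t : Fin (r + 1), φ t x ≤ b t} =
        (C ∩ {x | ∀ t : Fin r, φ (Fin.castSucc t) x ≤ b (Fin.castSucc t)}) ∩
          {x | φ (Fin.last r) x ≤ b (Fin.last r)} := by
      ext y
      simp only [Set.mem_inter_iff, Set.mem_setOf_eq, Fin.forall_fin_succ', and_assoc]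
    rw [← add_assoc, hset]
    exact h'

end Lifts

/-! ### Example 3.2: every convex pentagon has psd rank exactly four -/

section Pentagon

variable {x : Fin 5 → (Fin 2 → ℝ)}

/-- The quadrilateral on the first four vertices of a pentagon (drop the vertex `x₄`; GRT Ex. 3.2 drops
an inequality, here — by the symmetry of Lemma 3.1 — a point). [cite: GouveiaRobinsonThomas2015, Ex. 3.2 (p06)] -/
def dropLast (x : Fin 5 → (Fin 2 → ℝ)) : Fin 4 → (Fin 2 → ℝ) := fun k => x (Fin.castSucc k)

/-- Index map: the slack `(i, j)` of the quadrilateral is the pentagon slack `dropIdx i j`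
(inherited edges keep their slacks; the new edge `[x₃, x₀]` has slacks `S(3,0)` at `x₁` and `S(0,2)`
at `x₂`). [cite: GouveiaRobinsonThomas2015, Ex. 3.2 (p06)] -/
def dropIdx (i j : Fin 4) : Fin 5 × Fin 5 :=
  if j = 3 then (if i = 1 then (3, 0) else if i = 2 then (0, 2) else if i = 0 then (4, 3) else (3, 3))
  else (Fin.castSucc i, Fin.castSucc j)

/-- The quadrilateral's slacks are pentagon slacks. [cite: GouveiaRobinsonThomas2015, Ex. 3.2 (p06)] -/
theorem polygonSlack_dropLast (x : Fin 5 → (Fin 2 → ℝ)) (i j : Fin 4) :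
    polygonSlack (dropLast x) i j = polygonSlack x (dropIdx i j).1 (dropIdx i j).2 := by
  fin_cases i <;> fin_cases j <;> simp [polygonSlack_apply, dropLast, dropIdx] <;> ring

/-- Four vertices of a convex pentagon are a convex quadrilateral. [cite: GouveiaRobinsonThomas2015, Ex. 3.2 (p06)] -/
theorem isConvexPolygon_dropLast (hx : IsConvexPolygon x) : IsConvexPolygon (dropLast x) := by
  intro i j hij hij1
  rw [polygonSlack_dropLast]
  fin_cases i <;> fin_cases j <;>
    first | exact absurd rfl hij | exact absurd (by decide) hij1 | exact hx _ _ (by decide) (by decide)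

/-- **GRT Example 3.2, the upper bound** (p06: "Since a pentagon can be obtained by adding an inequality
to the facet description of a quadrilateral, Lemma 3.1 implies that all pentagons have psd rank
exactly four"): the slack matrix of every convex pentagon has a psd factorization of size `4`. Proof
(dual form of the printed one, at the level of slack matrices): the quadrilateral `Q = conv{x₀,…,x₃}`
has an `S^3_+`-factorization (`A_k`, `B_c`) (GRT 2013 Thm. 4.7); the two pentagon edges at the dropped
vertex `x₄` are valid on `Q` and tight at a vertex of `Q`, so on the vertices of `Q` their slacks are
nonnegative combinations of the slacks of the two edges of `Q` at that vertex
(`ℓ₃ = μ ℓ₂ + ν ℓ_{[x₃,x₀]}`, `ℓ₄ = μ' ℓ₀ + ν' ℓ_{[x₃,x₀]}`), giving factors `μ B₂ + ν B₃`,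
`μ' B₀ + ν' B₃`; then the row of `x₄` is appended (Lemma 3.1). [cite: GouveiaRobinsonThomas2015, Ex. 3.2 (p06) and Lemma 3.1 (p06)] -/
theorem IsConvexPolygon.hasPsdFactorization_four_pentagon (hx : IsConvexPolygon x) :
    HasPsdFactorization (polygonSlack x) 4 := by
  obtain ⟨A, B, hA, hB, hQ⟩ := (isConvexPolygon_dropLast hx).hasPsdFactorization_three_of_eq_four rfl
  have hQ' : ∀ k c, (A k * B c).trace = polygonSlack x (dropIdx k c).1 (dropIdx k c).2 :=
    fun k c => (hQ k c).symm.trans (polygonSlack_dropLast x k c)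
  have h02 : 0 < polygonSlack x 0 2 := hx 0 2 (by decide) (by decide)
  have h30 : 0 < polygonSlack x 3 0 := hx 3 0 (by decide) (by decide)
  -- the multipliers `ℓ₃ = μ ℓ₂ + ν ℓ_{[x₃,x₀]}`, `ℓ₄ = μ' ℓ₀ + ν' ℓ_{[x₃,x₀]}` on the vertices of `Q`
  have hμ : 0 ≤ polygonSlack x 0 3 / polygonSlack x 0 2 := div_nonneg (hx.nonneg 0 3) h02.le
  have hν : 0 ≤ polygonSlack x 2 3 / polygonSlack x 0 2 := div_nonneg (hx.nonneg 2 3) h02.le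
  have hμ' : 0 ≤ polygonSlack x 3 4 / polygonSlack x 3 0 := div_nonneg (hx.nonneg 3 4) h30.le
  have hν' : 0 ≤ polygonSlack x 1 4 / polygonSlack x 3 0 := div_nonneg (hx.nonneg 1 4) h30.le
  let B₃ : Matrix (Fin 3) (Fin 3) ℝ :=
    (polygonSlack x 0 3 / polygonSlack x 0 2) • B 2 + (polygonSlack x 2 3 / polygonSlack x 0 2) • B 3
  let B₄ : Matrix (Fin 3) (Fin 3) ℝ :=
    (polygonSlack x 3 4 / polygonSlack x 3 0) • B 0 + (polygonSlack x 1 4 / polygonSlack x 3 0) • B 3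
  let B' : Fin 5 → Matrix (Fin 3) (Fin 3) ℝ := ![B 0, B 1, B 2, B₃, B₄]
  -- traces against the new factors, in pentagon slacks
  have t3 : ∀ k, (A k * B₃).trace =
      polygonSlack x 0 3 / polygonSlack x 0 2 * polygonSlack x (dropIdx k 2).1 (dropIdx k 2).2 +
        polygonSlack x 2 3 / polygonSlack x 0 2 * polygonSlack x (dropIdx k 3).1 (dropIdx k 3).2 := by
    intro k
    simp only [B₃, Matrix.mul_add, Matrix.mul_smul, trace_add, trace_smul, smul_eq_mul, hQ']
  have t4 : ∀ k, (A k * B₄).trace =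
      polygonSlack x 3 4 / polygonSlack x 3 0 * polygonSlack x (dropIdx k 0).1 (dropIdx k 0).2 +
        polygonSlack x 1 4 / polygonSlack x 3 0 * polygonSlack x (dropIdx k 3).1 (dropIdx k 3).2 := by
    intro k
    simp only [B₄, Matrix.mul_add, Matrix.mul_smul, trace_add, trace_smul, smul_eq_mul, hQ']
  have e02 : (x 3 0 - x 2 0) * (x 0 1 - x 2 1) - (x 3 1 - x 2 1) * (x 0 0 - x 2 0) ≠ 0 := by
    simpa [polygonSlack_apply] using h02.ne'
  have e30 : (x 1 0 - x 0 0) * (x 3 1 - x 0 1) - (x 1 1 - x 0 1) * (x 3 0 - x 0 0) ≠ 0 := by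
    simpa [polygonSlack_apply] using h30.ne'
  refine hasPsdFactorization_succ_of_castSucc (M := polygonSlack x) (k := 3)
    ⟨A, B', hA, fun c => ?_, fun k c => ?_⟩ (fun c => hx.nonneg 4 c)
  · fin_cases c
    · exact hB 0
    · exact hB 1
    · exact hB 2
    · exact ((hB 2).smul hμ).add ((hB 3).smul hν)
    · exact ((hB 0).smul hμ').add ((hB 3).smul hν')
  · fin_cases c
    · show polygonSlack x _ 0 = (A k * B 0).trace
      rw [hQ']; fin_cases k <;> rfl
    · show polygonSlack x _ 1 = (A k * B 1).trace
      rw [hQ']; fin_cases k <;> rfl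
    · show polygonSlack x _ 2 = (A k * B 2).trace
      rw [hQ']; fin_cases k <;> rfl
    · show polygonSlack x _ 3 = (A k * B₃).trace
      rw [t3]
      have z32 : polygonSlack x 3 2 = 0 := by
        rw [show (3 : Fin 5) = 2 + 1 from rfl]; exact polygonSlack_succ x 2
      fin_cases k
      · simp [dropIdx, polygonSlack_apply]; field_simp; ring
      · simp [dropIdx, polygonSlack_apply]; field_simp; ring
      · simp [dropIdx, polygonSlack_apply]; field_simp
      · simp [dropIdx, z32]
    · show polygonSlack x _ 4 = (A k * B₄).trace
      rw [t4]
      fin_cases k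
      · simp [dropIdx, polygonSlack_apply]; field_simp; ring
      · simp [dropIdx, polygonSlack_apply]; field_simp; ring
      · simp [dropIdx, polygonSlack_apply]; field_simp; ring
      · simp [dropIdx, polygonSlack_apply]; field_simp

/-- **GRT Example 3.2** (p06, verbatim): "all pentagons have psd rank exactly four" — for every convex
pentagon the slack matrix has a psd factorization of size `4` and none of size `3` (GRT 2013 Thm. 4.7,
`IsConvexPolygon.four_le_of_hasPsdFactorization`). [cite: GouveiaRobinsonThomas2015, Ex. 3.2 (p06)] -/
theorem GouveiaRobinsonThomas2015_ex32 (hx : IsConvexPolygon x) :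
    HasPsdFactorization (polygonSlack x) 4 ∧ ¬ HasPsdFactorization (polygonSlack x) 3 :=
  ⟨hx.hasPsdFactorization_four_pentagon, hx.not_hasPsdFactorization_three (by norm_num)⟩

/-- Example 3.2 as a statement on psd LIFTS (with FGPRT Thm. 3.3, `IsConvexPolygon.hasPsdLift_iff`): a
convex pentagon is a linear image of an affine slice of `S^4_+`, and of no smaller psd cone.
[cite: GouveiaRobinsonThomas2015, Ex. 3.2 (p06)] -/
theorem GouveiaRobinsonThomas2015_ex32_lift (hx : IsConvexPolygon x) :
    HasPsdLift (convexHull ℝ (Set.range x)) 4 ∧ ∀ k, HasPsdLift (convexHull ℝ (Set.range x)) k → 4 ≤ k :=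
  ⟨(hx.hasPsdLift_iff (by norm_num) (by norm_num)).mpr hx.hasPsdFactorization_four_pentagon,
    fun _ hk => hx.four_le_of_hasPsdLift (by norm_num) hk⟩

end Pentagon

/-! ### Dropping a vertex of a convex `m`-gon: Lemma 3.1 for all polygons -/

section GeneralPolygon

variable {M : ℕ} [NeZero M]

/-- The index `t < M` as an element of `Fin M` (bookkeeping). [folklore] -/
private def ix (t : ℕ) (ht : t < M) : Fin M := ⟨t, ht⟩

omit [NeZero M] in
/-- Values of `ix`. [folklore] -/
private theorem ix_val {t : ℕ} (ht : t < M) : (ix t ht : Fin M).val = t := rfl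

/-- Successor of a small index (bookkeeping). [folklore] -/
private theorem ix_succ {t : ℕ} (ht : t + 1 < M) : (ix t (by omega) + 1 : Fin M) = ix (t + 1) ht := by
  apply Fin.ext
  rw [Fin.val_add, Fin.val_one', ix_val, ix_val, Nat.add_mod_mod, Nat.mod_eq_of_lt ht]

/-- `ix 0 = 0`. [folklore] -/
private theorem ix_zero : (ix 0 (Nat.pos_of_ne_zero (NeZero.ne M)) : Fin M) = 0 := rfl

omit [NeZero M] in
/-- Distinct small naturals give distinct indices (bookkeeping). [folklore] -/
private theorem ix_ne {s t : ℕ} (hs : s < M) (ht : t < M) (h : s ≠ t) : ix s hs ≠ ix t ht := by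
  intro he; exact h (by simpa [ix] using congrArg Fin.val he)

/-- **Cyclic relabeling** keeps a convex polygon convex (start the vertex list at `x_a`). [folklore] -/
private theorem IsConvexPolygon.rotate {x : Fin M → (Fin 2 → ℝ)} (hx : IsConvexPolygon x) (a : Fin M) :
    IsConvexPolygon (fun i => x (a + i)) := by
  intro i j hij hij1
  have h := hx (a + i) (a + j) (by simpa using hij) (by rw [add_assoc]; simpa using hij1)
  simpa [polygonSlack, add_assoc] using h

/-- The Grassmann–Plücker relation for four plane vectors. [folklore] -/
private theorem cross2_plucker (r u v w : Fin 2 → ℝ) :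
    cross2 r v * cross2 u w = cross2 r u * cross2 v w + cross2 r w * cross2 u v := by
  simp only [cross2]; ring

/-- **Three vertices of a convex polygon in cyclic order are positively oriented** (base vertex `x₀`):
for `0 < s < t < M`, `det(x_s − x₀, x_t − x₀) > 0`. Proof: the vectors `w_i = x_i − x₀` (`i ≥ 1`) all
lie strictly on the left of `w₁` (edge `[x₀,x₁]`) and consecutive ones turn left (edge `[x_b,x_{b+1}]`
seen from `x₀`); in a half-plane "turns left of" is transitive (Grassmann–Plücker). [folklore] -/
private theorem IsConvexPolygon.cross2_pos_zero {y : Fin M → (Fin 2 → ℝ)} (hy : IsConvexPolygon y) :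
    ∀ (t s : ℕ) (hs : 0 < s) (hst : s < t) (ht : t < M),
      0 < cross2 (y (ix s (by omega)) - y (ix 0 (by omega))) (y (ix t ht) - y (ix 0 (by omega))) := by
  have h0 : 0 < M := Nat.pos_of_ne_zero (NeZero.ne M)
  -- (F1): `x_c` is left of the edge `[x₀, x₁]`
  have F1 : ∀ (c : ℕ) (hc2 : 2 ≤ c) (hc : c < M),
      0 < cross2 (y (ix 1 (by omega)) - y (ix 0 h0)) (y (ix c hc) - y (ix 0 h0)) := by
    intro c hc2 hc
    have h1 : 0 + 1 < M := by omega
    have hne1 : ix c hc ≠ ix 0 h0 + 1 := by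
      rw [ix_succ h1]
      exact ix_ne hc h1 (by omega)
    have h := hy (ix c hc) (ix 0 h0) (ix_ne hc h0 (by omega)) hne1
    rw [polygonSlack, Matrix.of_apply, ix_succ h1] at h
    exact h
  -- (F2): consecutive vertices turn left as seen from `x₀`
  have F2 : ∀ (b : ℕ) (hb1 : 1 ≤ b) (hb : b + 1 < M),
      0 < cross2 (y (ix b (by omega)) - y (ix 0 h0)) (y (ix (b + 1) hb) - y (ix 0 h0)) := by
    intro b hb1 hb
    have h := hy (ix 0 h0) (ix b (by omega)) (ix_ne h0 (by omega) (by omega))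
      (by rw [ix_succ hb]; exact ix_ne h0 hb (by omega))
    rw [polygonSlack, Matrix.of_apply, ix_succ hb] at h
    have e : cross2 (y (ix b (by omega)) - y (ix 0 h0)) (y (ix (b + 1) hb) - y (ix 0 h0)) =
        cross2 (y (ix (b + 1) hb) - y (ix b (by omega))) (y (ix 0 h0) - y (ix b (by omega))) := by
      simp only [cross2, Pi.sub_apply]; ring
    rwa [e]
  intro t
  induction t with
  | zero => intro s hs hst; omega
  | succ t ih =>
    intro s hs hst ht
    rcases Nat.lt_or_ge s t with hlt | hge
    · -- `s < t < t + 1`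
      rcases Nat.lt_or_ge s 2 with hs1 | hs2
      · -- `s = 1`
        have hs1' : s = 1 := by omega
        subst hs1'
        exact F1 (t + 1) (by omega) ht
      · have hC := ih s hs hlt (by omega)
        have hP := cross2_plucker (y (ix 1 (by omega)) - y (ix 0 h0)) (y (ix s (by omega)) - y (ix 0 h0))
          (y (ix t (by omega)) - y (ix 0 h0)) (y (ix (t + 1) ht) - y (ix 0 h0))
        have h1t := F1 t (by omega) (by omega)
        have h1s := F1 s hs2 (by omega)
        have h1t1 := F1 (t + 1) (by omega) ht
        have hF2 := F2 t (by omega) ht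
        nlinarith [mul_pos h1s hF2, mul_pos h1t1 hC]
    · -- `s = t`
      have hst' : s = t := by omega
      subst hst'
      exact F2 s hs ht

/-- **Cyclically ordered vertices of a convex polygon are positively oriented**: for every vertex
`x_a` and offsets `0 < s < t < M`, `det(x_{a+s} − x_a, x_{a+t} − x_a) > 0` (convex position of
the vertex list, as used for "convex polygon with `k` vertices"). [cite: GouveiaRobinsonThomas2013, Thm. 4.7 (p11, "convex polygon")] -/
theorem IsConvexPolygon.cross2_pos {x : Fin M → (Fin 2 → ℝ)} (hx : IsConvexPolygon x) (a : Fin M)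
    {s t : ℕ} (hs : 0 < s) (hst : s < t) (ht : t < M) :
    0 < cross2 (x (a + ⟨s, by omega⟩) - x a) (x (a + ⟨t, ht⟩) - x a) := by
  have h := (hx.rotate a).cross2_pos_zero t s hs hst ht
  simpa [ix] using h

end GeneralPolygon

/-! ### Lemma 3.1 for all convex polygons: dropping a vertex costs at most one -/

section DropVertex

variable {m : ℕ} [NeZero m]

/-- Drop the last vertex `x_m` of an `(m+1)`-gon. [cite: GouveiaRobinsonThomas2015, Lemma 3.1 (p06)] -/
def dropVertex (x : Fin (m + 1) → (Fin 2 → ℝ)) : Fin m → (Fin 2 → ℝ) := fun k => x (Fin.castSucc k)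

/-- Cramer's rule for the cross product: `det(w,z) = (det(w,v)/det(u,v)) det(u,z) + (det(u,w)/det(u,v)) det(v,z)`. [folklore] -/
private theorem cross2_cramer (u v w z : Fin 2 → ℝ) (h : cross2 u v ≠ 0) :
    cross2 w z = cross2 w v / cross2 u v * cross2 u z + cross2 u w / cross2 u v * cross2 v z := by
  rw [div_mul_eq_mul_div, div_mul_eq_mul_div, ← add_div, eq_div_iff h]
  simp only [cross2]
  ring

omit [NeZero m] in
/-- Index bookkeeping: `castSucc c + 1 = castSucc (c + 1)` away from the last index. [folklore] -/
private theorem castSucc_add_one [NeZero m] (c : Fin m) (hc : c.val + 1 < m) :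
    (Fin.castSucc c : Fin (m + 1)) + 1 = Fin.castSucc (c + 1) := by
  rw [Fin.ext_iff]
  simp only [Fin.val_add, Fin.val_castSucc, Fin.val_one', Nat.mod_eq_of_lt (show 1 < m + 1 by omega),
    Nat.mod_eq_of_lt (show 1 < m by omega), Nat.mod_eq_of_lt (show c.val + 1 < m + 1 by omega),
    Nat.mod_eq_of_lt hc]

/-- Index bookkeeping: the last index of `Fin m` plus one is `0`. [folklore] -/
private theorem lastIdx_add_one (hm : 2 ≤ m) : (⟨m - 1, by omega⟩ + 1 : Fin m) = 0 := by
  apply Fin.ext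
  rw [Fin.val_add, Fin.val_one', Nat.mod_eq_of_lt (show 1 < m by omega), Fin.val_zero,
    show m - 1 + 1 = m by omega, Nat.mod_self]

omit [NeZero m] in
/-- Index bookkeeping in `Fin (m+1)`: `⟨t⟩ + 1 = ⟨t+1⟩`. [folklore] -/
private theorem mk_add_one {t s : ℕ} (ht : t < m + 1) (hs : s < m + 1) (h : s = t + 1) :
    (⟨t, ht⟩ + 1 : Fin (m + 1)) = ⟨s, hs⟩ := by
  subst h
  rw [Fin.ext_iff]
  simp only [Fin.val_add, Fin.val_one', Nat.mod_eq_of_lt (show 1 < m + 1 by omega), Nat.mod_eq_of_lt hs]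

/-- Inherited edges keep their slacks. [cite: GouveiaRobinsonThomas2015, Lemma 3.1 (p06)] -/
theorem polygonSlack_dropVertex_of_lt (x : Fin (m + 1) → (Fin 2 → ℝ)) (k c : Fin m)
    (hc : c.val + 1 < m) :
    polygonSlack (dropVertex x) k c = polygonSlack x (Fin.castSucc k) (Fin.castSucc c) := by
  simp only [polygonSlack, Matrix.of_apply, dropVertex, castSucc_add_one c hc]

/-- The new edge `[x_{m-1}, x_0]` of the smaller polygon. [cite: GouveiaRobinsonThomas2015, Lemma 3.1 (p06)] -/
theorem polygonSlack_dropVertex_last (x : Fin (m + 1) → (Fin 2 → ℝ)) (k : Fin m) (hm : 2 ≤ m) :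
    polygonSlack (dropVertex x) k ⟨m - 1, by omega⟩ =
      cross2 (x 0 - x ⟨m - 1, by omega⟩) (x (Fin.castSucc k) - x ⟨m - 1, by omega⟩) := by
  simp only [polygonSlack, Matrix.of_apply, dropVertex, lastIdx_add_one hm, Fin.castSucc_zero]
  rfl

/-- **Dropping a vertex of a convex polygon leaves a convex polygon** (`m ≥ 3` remaining vertices;
the new edge `[x_{m−1}, x_0]` sees the other vertices on its inner side by `IsConvexPolygon.cross2_pos`).
[cite: GouveiaRobinsonThomas2015, Lemma 3.1 (p06)] -/
theorem isConvexPolygon_dropVertex {x : Fin (m + 1) → (Fin 2 → ℝ)} (hx : IsConvexPolygon x)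
    (hm : 3 ≤ m) : IsConvexPolygon (dropVertex x) := by
  intro k c hkc hkc1
  by_cases hc : c.val + 1 < m
  · rw [polygonSlack_dropVertex_of_lt x k c hc]
    refine hx _ _ (fun h => hkc (Fin.castSucc_injective _ h)) fun h => hkc1 ?_
    rw [castSucc_add_one c hc] at h
    exact Fin.castSucc_injective _ h
  · have hcv : c = ⟨m - 1, Nat.sub_one_lt (NeZero.ne m)⟩ := Fin.ext (by simp; omega)
    rw [hcv] at hkc hkc1 ⊢
    rw [polygonSlack_dropVertex_last x k (by omega)]
    have hk0 : k.val ≠ 0 := fun h0 => hkc1 (by rw [lastIdx_add_one (by omega)]; exact Fin.ext h0)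
    have hk1 : k.val ≠ m - 1 := fun h1 => hkc (Fin.ext h1)
    have h := hx.cross2_pos ⟨m - 1, by omega⟩ (s := 2) (t := k.val + 2) (by norm_num) (by omega)
      (by omega)
    have e1 : ((⟨m - 1, by omega⟩ : Fin (m + 1)) + ⟨2, by omega⟩) = 0 := by
      apply Fin.ext; rw [Fin.val_add]; simp [show m - 1 + 2 = m + 1 by omega]
    have e2 : ((⟨m - 1, by omega⟩ : Fin (m + 1)) + ⟨k.val + 2, by omega⟩) = Fin.castSucc k := by
      apply Fin.ext
      rw [Fin.val_add, Fin.val_castSucc, show m - 1 + (k.val + 2) = k.val + (m + 1) by omega,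
        Nat.add_mod_right, Nat.mod_eq_of_lt (by omega)]
    rwa [e1, e2] at h

/-- **GRT Lemma 3.1 for polygons, dual form: dropping a vertex costs at most one.** If the slack matrix
of the convex `m`-gon `x₀,…,x_{m−1}` (`m ≥ 3`) has a psd factorization of size `r`, then that of the
convex `(m+1)`-gon `x₀,…,x_m` has one of size `r + 1`: the two edges at `x_m` are valid on the
smaller polygon and tight at its vertices `x_{m−1}`, `x₀`, so on its vertices they are the nonnegative
combinations (Cramer) `ℓ_{[x_{m−1},x_m]} = μ ℓ_{[x_{m−2},x_{m−1}]} + ν ℓ_{[x_{m−1},x_0]}`,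
`ℓ_{[x_m,x_0]} = α ℓ_{[x_{m−1},x_0]} + β ℓ_{[x_0,x_1]}`, giving psd factors for the two new columns;
then the row of `x_m` is appended (`hasPsdFactorization_succ_of_castSucc`).
[cite: GouveiaRobinsonThomas2015, Lemma 3.1 (p06) and Ex. 3.2 (p06)] -/
theorem IsConvexPolygon.hasPsdFactorization_succ_of_dropVertex {x : Fin (m + 1) → (Fin 2 → ℝ)}
    (hx : IsConvexPolygon x) (hm : 3 ≤ m) {r : ℕ}
    (h : HasPsdFactorization (polygonSlack (dropVertex x)) r) :
    HasPsdFactorization (polygonSlack x) (r + 1) := by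
  obtain ⟨A, B, hA, hB, hQ⟩ := h
  -- indices
  let q0 : Fin m := 0
  let q1 : Fin m := ⟨1, by omega⟩
  let qm2 : Fin m := ⟨m - 2, by omega⟩
  let qm1 : Fin m := ⟨m - 1, by omega⟩
  let p0 : Fin (m + 1) := 0
  let p1 : Fin (m + 1) := ⟨1, by omega⟩
  let pm2 : Fin (m + 1) := ⟨m - 2, by omega⟩
  let pm1 : Fin (m + 1) := ⟨m - 1, by omega⟩
  let pm : Fin (m + 1) := Fin.last m
  have hQ' := isConvexPolygon_dropVertex hx hm
  -- the Cramer vectors at `x_{m-1}` and at `x_0`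
  let u : Fin 2 → ℝ := x pm1 - x pm2
  let v : Fin 2 → ℝ := x p0 - x pm1
  let w : Fin 2 → ℝ := x pm - x pm1
  let u' : Fin 2 → ℝ := x p0 - x pm1
  let v' : Fin 2 → ℝ := x p1 - x p0
  let w' : Fin 2 → ℝ := x p0 - x pm
  -- their determinants are slack entries
  have e_pm2 : pm2 + 1 = pm1 := mk_add_one _ _ (by omega)
  have e_pm1 : pm1 + 1 = pm := mk_add_one _ _ (by omega)
  have e_pm : pm + 1 = p0 := Fin.last_add_one m
  have e_p0 : p0 + 1 = p1 := Fin.ext (by simp [p0, p1, Nat.mod_eq_of_lt (show 1 < m + 1 by omega)])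
  have huv : cross2 u v = polygonSlack x p0 pm2 := by
    rw [polygonSlack, Matrix.of_apply, e_pm2]; simp only [cross2, Pi.sub_apply, u, v]; ring
  have hwv : cross2 w v = polygonSlack x p0 pm1 := by
    rw [polygonSlack, Matrix.of_apply, e_pm1]
  have huw : cross2 u w = polygonSlack x pm pm2 := by
    rw [polygonSlack, Matrix.of_apply, e_pm2]; simp only [cross2, Pi.sub_apply, u, w]; ring
  have hu'v' : cross2 u' v' = polygonSlack (dropVertex x) q1 qm1 := by
    rw [polygonSlack_dropVertex_last x q1 (by omega)]
    simp only [cross2, Pi.sub_apply, u', v', q1, p0, p1, pm1, Fin.castSucc_mk]; ring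
  have hw'v' : cross2 w' v' = polygonSlack x p1 pm := by
    rw [polygonSlack, Matrix.of_apply, e_pm]; simp only [cross2, Pi.sub_apply, w', v']; ring
  have hu'w' : cross2 u' w' = polygonSlack x p0 pm1 := by
    rw [polygonSlack, Matrix.of_apply, e_pm1]; simp only [cross2, Pi.sub_apply, u', w']; ring
  have huv_pos : 0 < cross2 u v := by
    rw [huv]; exact hx p0 pm2 (by simp [p0, pm2, Fin.ext_iff]; omega) (by rw [e_pm2]; simp [p0, pm1, Fin.ext_iff]; omega)
  have hu'v'_pos : 0 < cross2 u' v' := by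
    rw [hu'v']
    exact hQ' q1 qm1 (by simp [q1, qm1, Fin.ext_iff]; omega)
      (by rw [show qm1 = ⟨m - 1, by omega⟩ from rfl, lastIdx_add_one (by omega)]; simp [q1, Fin.ext_iff])
  -- the new factors
  let Bμν : Matrix (Fin r) (Fin r) ℝ := (cross2 w v / cross2 u v) • B qm2 + (cross2 u w / cross2 u v) • B qm1
  let Bαβ : Matrix (Fin r) (Fin r) ℝ := (cross2 w' v' / cross2 u' v') • B qm1 + (cross2 u' w' / cross2 u' v') • B q0
  have hBμν : Bμν.PosSemidef :=
    ((hB qm2).smul (div_nonneg (hwv ▸ hx.nonneg _ _) huv_pos.le)).add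
      ((hB qm1).smul (div_nonneg (huw ▸ hx.nonneg _ _) huv_pos.le))
  have hBαβ : Bαβ.PosSemidef :=
    ((hB qm1).smul (div_nonneg (hw'v' ▸ hx.nonneg _ _) hu'v'_pos.le)).add
      ((hB q0).smul (div_nonneg (hu'w' ▸ hx.nonneg _ _) hu'v'_pos.le))
  let B' : Fin (m + 1) → Matrix (Fin r) (Fin r) ℝ := fun j =>
    if hj : j.val + 1 < m then B ⟨j.val, by omega⟩ else if j.val = m - 1 then Bμν else Bαβ
  refine hasPsdFactorization_succ_of_castSucc (M := polygonSlack x) (k := r)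
    ⟨A, B', hA, fun j => ?_, fun k j => ?_⟩ (fun c => hx.nonneg _ c)
  · simp only [B']
    split_ifs
    · exact hB _
    · exact hBμν
    · exact hBαβ
  · show polygonSlack x (Fin.castSucc k) j = (A k * B' j).trace
    by_cases hj : j.val + 1 < m
    · have hB'j : B' j = B ⟨j.val, by omega⟩ := by simp only [B', dif_pos hj]
      rw [hB'j, ← hQ, polygonSlack_dropVertex_of_lt x k _ hj]
      rfl
    · by_cases hj1 : j.val = m - 1
      · have hB'j : B' j = Bμν := by simp only [B', dif_neg hj, if_pos hj1]
        have hjv : j = pm1 := Fin.ext hj1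
        rw [hB'j, hjv]
        -- `ℓ_{[x_{m-1},x_m]}(x_k) = det(w, x_k − x_{m−1})`
        have lhs : polygonSlack x (Fin.castSucc k) pm1 = cross2 w (x (Fin.castSucc k) - x pm1) := by
          rw [polygonSlack, Matrix.of_apply, e_pm1]
        have t1 : (A k * B qm2).trace = cross2 u (x (Fin.castSucc k) - x pm1) := by
          rw [← hQ, polygonSlack_dropVertex_of_lt x k qm2 (by simp [qm2]; omega), polygonSlack,
            Matrix.of_apply, show Fin.castSucc qm2 = pm2 from rfl, e_pm2]
          simp only [cross2, Pi.sub_apply, u]; ring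
        have t2 : (A k * B qm1).trace = cross2 v (x (Fin.castSucc k) - x pm1) := by
          rw [← hQ, show qm1 = ⟨m - 1, by omega⟩ from rfl, polygonSlack_dropVertex_last x k (by omega)]
        rw [lhs, cross2_cramer u v w _ huv_pos.ne']
        simp only [Bμν, Matrix.mul_add, Matrix.mul_smul, trace_add, trace_smul, smul_eq_mul, t1, t2]
      · have hjm : j = pm := Fin.ext (by simp [pm]; omega)
        have hB'j : B' j = Bαβ := by simp only [B', dif_neg hj, if_neg hj1]
        rw [hB'j, hjm]
        have lhs : polygonSlack x (Fin.castSucc k) pm = cross2 w' (x (Fin.castSucc k) - x p0) := by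
          rw [polygonSlack, Matrix.of_apply, e_pm]; simp only [cross2, Pi.sub_apply, w']; ring
        have t1 : (A k * B qm1).trace = cross2 u' (x (Fin.castSucc k) - x p0) := by
          rw [← hQ, show qm1 = ⟨m - 1, by omega⟩ from rfl, polygonSlack_dropVertex_last x k (by omega)]
          simp only [cross2, Pi.sub_apply, u', p0, pm1]; ring
        have t2 : (A k * B q0).trace = cross2 v' (x (Fin.castSucc k) - x p0) := by
          rw [← hQ, polygonSlack_dropVertex_of_lt x k q0 (by simp [q0]; omega), polygonSlack,
            Matrix.of_apply, show Fin.castSucc q0 = p0 from rfl, e_p0]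
        rw [lhs, cross2_cramer u' v' w' _ hu'v'_pos.ne']
        simp only [Bαβ, Matrix.mul_add, Matrix.mul_smul, trace_add, trace_smul, smul_eq_mul, t1, t2]

/-- **Every convex `m`-gon has a psd factorization of size `m − 1`** (`m ≥ 4`): quadrilaterals have
psd rank `3` (GRT 2013) and each further vertex costs at most one (Lemma 3.1). (GRT p07 records the
better bounds `4` for hexagons — Thm. 3.4 — and hence "`7`-gons have psd rank four or five",
"`8`-gons … trivial upper bound of six".) [cite: GouveiaRobinsonThomas2015, Lemma 3.1 (p06) and §3 (p07)] -/
theorem IsConvexPolygon.hasPsdFactorization_sub_one :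
    ∀ (m : ℕ) [NeZero m] (x : Fin m → (Fin 2 → ℝ)), IsConvexPolygon x → 4 ≤ m →
      HasPsdFactorization (polygonSlack x) (m - 1) := by
  intro m
  induction m with
  | zero => intro _ x _ h; omega
  | succ m ih =>
    intro _ x hx hm
    rcases Nat.lt_or_ge m 4 with h4 | h4
    · have hm4 : m + 1 = 4 := by omega
      have h3 := hx.hasPsdFactorization_three_of_eq_four hm4
      simpa [hm4] using h3
    · haveI : NeZero m := ⟨by omega⟩
      have h := ih (dropVertex x) (isConvexPolygon_dropVertex hx (by omega)) h4
      have h' := hx.hasPsdFactorization_succ_of_dropVertex (by omega) h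
      simpa [show m - 1 + 1 = m + 1 - 1 by omega] using h'

end DropVertex

/-! ### The remaining results of §§2–3, typed as cited facts (not proved here) -/

section Facts

/-- **GRT Theorem 2.1** (p05, verbatim): "If `P ⊂ ℝⁿ` is a generic polytope with `v` vertices, then
its psd rank is at least `(nv)^{1/4}`." Here (p05) "a polytope `P ⊂ ℝⁿ` is said to be generic if the
coordinates of its vertices form an algebraically independent set over the rationals". Typed: for
`v` points `x_i ∈ ℝⁿ` with algebraically independent coordinates, each of which is a vertex (extreme
point) of the FULL-DIMENSIONAL polytope `P = conv{x_i}` (the printed proof writes the lift in the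
projection form `P = {x ∈ ℝⁿ : ∃ x_{n+1},…,x_{d_k−1}, g(x) ⪰ 0}`, which presupposes `dim P = n`;
without full-dimensionality the bound fails for degenerate `P`, e.g. a single generic point of `ℝ²`
has a psd lift of size `1 < 2^{1/4}`), every psd lift `P = π(S^k_+ ∩ L)` has `k ≥ (nv)^{1/4}`.
The printed proof uses SDP duality under Slater's condition, the Tarski–Seidenberg transfer to the
real closure of `ℚ(Γ)` and transcendence degrees; NAMED FACT, not proved here. (The first typing of
this fact omitted the full-dimensionality hypothesis; corrected here before any use.)
[cite: GouveiaRobinsonThomas2015, Thm. 2.1 (p05)] -/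
def GouveiaRobinsonThomas2015_thm21 : Prop :=
  ∀ (n v : ℕ) (x : Fin v → (Fin n → ℝ)),
    AlgebraicIndependent ℚ (fun p : Fin v × Fin n => x p.1 p.2) →
    (∀ i, x i ∈ (convexHull ℝ (Set.range x)).extremePoints ℝ) →
    (interior (convexHull ℝ (Set.range x))).Nonempty →
    ∀ k : ℕ, HasPsdLift (convexHull ℝ (Set.range x)) k → ((n : ℝ) * v) ^ (1 / 4 : ℝ) ≤ k

/-- **GRT Theorem 3.4** (p07, verbatim): "Every hexagon has psd rank exactly four." The lower bound is
the tree's `IsConvexPolygon.four_le_of_hasPsdFactorization` (GRT 2013 Thm. 4.7); the content typed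
here is the upper bound — the vertex/edge slack matrix of every convex hexagon (vertex list in
counterclockwise strictly convex position) has a psd factorization of size `4`. The printed proof lifts
the hexagon to a biplanar octahedron in `ℝ³` (GRT 2013 Thm. 4.8, rank of `√S_O` by row reduction) and
projects (Lemma 3.3); typed as a named fact and PROVED below (`GouveiaRobinsonThomas2015_thm34_holds`,
through `IsConvexPolygon.hasPsdFactorization_four_hexagon`). [cite: GouveiaRobinsonThomas2015, Thm. 3.4 (p07)] -/
def GouveiaRobinsonThomas2015_thm34 : Prop :=
  ∀ x : Fin 6 → (Fin 2 → ℝ), IsConvexPolygon x → HasPsdFactorization (polygonSlack x) 4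

/-- Theorem 3.4 with its lower bound: given the fact, every convex hexagon has psd rank EXACTLY four.
[cite: GouveiaRobinsonThomas2015, Thm. 3.4 (p07)] -/
theorem GouveiaRobinsonThomas2015_thm34.exact (h : GouveiaRobinsonThomas2015_thm34)
    {x : Fin 6 → (Fin 2 → ℝ)} (hx : IsConvexPolygon x) :
    HasPsdFactorization (polygonSlack x) 4 ∧ ¬ HasPsdFactorization (polygonSlack x) 3 :=
  ⟨h x hx, hx.not_hasPsdFactorization_three (by norm_num)⟩

/-- **GRT Theorem 3.7** (p07, verbatim): "Let `M` be a nonnegative `p × q` matrix with `rank(M) = 3`.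
Then `rank_psd(M) ≤ 4⌈min{p,q}/6⌉`. In particular, the psd rank of a `v`-gon is at most `4⌈v/6⌉`."
(Printed proof: a `6 × q` nonnegative rank-three matrix is a generalized slack matrix of a hexagon
inside a `q`-gon, Prop. 3.6 and Thm. 3.4, then concatenation of column blocks.) Typed here as a
named fact; its polygon clause is PROVED below (`GouveiaRobinsonThomas2015_thm37_polygon`) and the
fact itself is DISCHARGED in `RankThreePsdRank.lean` (`GouveiaRobinsonThomas2015_thm37_holds`: the
rows of a nonnegative rank-three matrix are positive multiples of planar points, the extreme ones
form a convex polygon by `PlanarConvexHullPolygon.exists_isConvexPolygon_of_finite`, the others are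
convex combinations); `⌈t/6⌉ = (t + 5) / 6` in `ℕ`. [cite: GouveiaRobinsonThomas2015, Thm. 3.7 (p07)] -/
def GouveiaRobinsonThomas2015_thm37 : Prop :=
  ∀ (p q : ℕ) (M : Matrix (Fin p) (Fin q) ℝ), (∀ i j, 0 ≤ M i j) → M.rank = 3 →
    HasPsdFactorization M (4 * ((min p q + 5) / 6))

/-- **The polygon clause of Theorem 3.7** (p07: "the psd rank of a `v`-gon is at most `4⌈v/6⌉`") for
`v ≤ 5`, PROVED (triangles and quadrilaterals have psd rank `3 ≤ 4`, pentagons `4`); all `v` in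
`IsConvexPolygon.hasPsdFactorization_four_mul_ceil_div_six` below. [cite: GouveiaRobinsonThomas2015, Thm. 3.7 (p07) and Ex. 3.2 (p06)] -/
theorem GouveiaRobinsonThomas2015_thm37_polygon_of_le_five {m : ℕ} [NeZero m]
    (x : Fin m → (Fin 2 → ℝ)) (hm : 3 ≤ m) (hm5 : m ≤ 5) (hx : IsConvexPolygon x) :
    HasPsdFactorization (polygonSlack x) (4 * ((m + 5) / 6)) := by
  have h46 : 4 * ((m + 5) / 6) = 4 := by omega
  rw [h46]
  rcases Nat.lt_or_ge m 5 with h4 | h5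
  · exact ((GouveiaRobinsonThomas2013_thm47 hx hm).mpr (by omega)).mono (by norm_num)
  · obtain rfl : m = 5 := le_antisymm hm5 h5
    exact hx.hasPsdFactorization_four_pentagon

/-- **Consequence of Theorem 3.4 for all polygons** (p07: "all `7`-gons have psd rank either four or
five by Theorem 3.4, Lemma 3.1 …, … `8`-gons … the trivial upper bound of six"): given the hexagon
fact, every convex `m`-gon with `m ≥ 6` has a psd factorization of size `m − 2` (drop vertices one
at a time, `IsConvexPolygon.hasPsdFactorization_succ_of_dropVertex`). [cite: GouveiaRobinsonThomas2015, §3 (p07)] -/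
theorem GouveiaRobinsonThomas2015_thm34.hasPsdFactorization_sub_two (h34 : GouveiaRobinsonThomas2015_thm34) :
    ∀ (m : ℕ) [NeZero m] (x : Fin m → (Fin 2 → ℝ)), IsConvexPolygon x → 6 ≤ m →
      HasPsdFactorization (polygonSlack x) (m - 2) := by
  intro m
  induction m with
  | zero => intro _ x _ h; omega
  | succ m ih =>
    intro _ x hx hm
    rcases Nat.lt_or_ge m 6 with h6 | h6
    · have hm6 : m = 5 := by omega
      subst hm6
      exact h34 x hx
    · haveI : NeZero m := ⟨by omega⟩
      have h := ih (dropVertex x) (isConvexPolygon_dropVertex hx (by omega)) h6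
      have h' := hx.hasPsdFactorization_succ_of_dropVertex (by omega) h
      simpa [show m - 2 + 1 = m + 1 - 2 by omega] using h'

end Facts

/-! ### Theorem 3.4 PROVED: every convex hexagon has psd rank exactly four

The printed proof lifts the (affinely normalised) hexagon to the biplanar octahedron
`O = conv{0, e₁, e₂, e₃, (v₁,0,v₃), (0,w₂,w₃)}` and projects it back by `π(y) = (y₁ + a y₃, y₂ + b y₃)`
(p07); `rank_psd(O) = 4` is GRT 2013 Thm. 4.8 ("row reduction shows that `√⁺S_O` has rank four").
Here, affine-invariantly: the three pairs of opposite vertices of `O` sit over the diagonals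
`{x_i, x_{i+3}}`, the six facets of `O` through hexagon edges sit over the consecutive vertex triples
`{x_k, x_{k+1}, x_{k+2}}`, and on the `6 × 6` block (vertices × these facets) the slack matrix of `O`
is, up to positive row/column scaling, the entrywise square of the rank-four matrix `(u_i · v_k)`
below, whose entries are square roots of the six hexagon slacks `S₃₀, S₄₀, S₂₅, S₃₅, S₁₃, S₅₂`
(`S_{ij} = polygonSlack x i j`). The edge `[x_j, x_{j+1}]` of the hexagon is an edge of `O`; its
functional is the nonnegative combination `λ_j ℓ_{T_j} + μ_j ℓ_{T_{j-1}}` of the two facets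
`T_j = {x_j,x_{j+1},x_{j+2}}`, `T_{j-1} = {x_{j-1},x_j,x_{j+1}}` of `O` containing it — on the vertices
these are three-term Grassmann–Plücker identities, checked as polynomial identities in the twelve
coordinates after clearing denominators by positive rescalings (FGPRT Thm. 2.9 (ii),
`hasPsdFactorization_rescale_iff`). -/

section Hexagon

/-- Row vectors `u_i ∈ ℝ⁴` of the rank-four Hadamard square root, in the six square-root parameters
`s = (√S₃₀, √S₄₀, √S₂₅, √S₃₅, √S₁₃, √S₅₂)`. [cite: GouveiaRobinsonThomas2013, Thm. 4.8 (p11–12)] -/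
private def hexRow (s : Fin 6 → ℝ) : Fin 6 → Fin 4 → ℝ :=
  ![![1, 0, 0, 0], ![s 4, s 1, 0, -s 0], ![0, 0, 1, 0], ![0, 1, 0, 0], ![0, 0, 0, 1],
    ![s 5, s 2, -s 3, 0]]

/-- Column vectors `v_k ∈ ℝ⁴` (facet `{x_k, x_{k+1}, x_{k+2}}` of the lifted octahedron).
[cite: GouveiaRobinsonThomas2013, Thm. 4.8 (p11–12)] -/
private def hexCol (s : Fin 6 → ℝ) : Fin 6 → Fin 4 → ℝ :=
  ![![0, s 0, 0, s 1], ![s 0, 0, 0, s 4], ![1, 0, 0, 0], ![s 3, 0, s 5, 0], ![0, s 3, s 2, 0],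
    ![0, s 3 * s 0, s 2 * s 0, s 1 * s 3]]

/-- The squares `(u_i · v_k)²` as monomials in `g_m = s_m²` (the octahedron's facet slacks).
[cite: GouveiaRobinsonThomas2013, Thm. 4.8 (p11–12)] -/
private def hexQ (g : Fin 6 → ℝ) : Fin 6 → Fin 6 → ℝ :=
  ![![0, g 0, 1, g 3, 0, 0], ![0, 0, g 4, g 4 * g 3, g 1 * g 3, 0], ![0, 0, 0, g 5, g 2, g 2 * g 0],
    ![g 0, 0, 0, 0, g 3, g 3 * g 0], ![g 1, g 4, 0, 0, 0, g 1 * g 3], ![g 2 * g 0, g 5 * g 0, g 5, 0, 0, 0]]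

/-- `(u_i · v_k)² = Q_{ik}(s²)` (pure algebra). [cite: GouveiaRobinsonThomas2013, Thm. 4.8 (p11–12)] -/
private theorem hexRow_dot_hexCol_sq (s : Fin 6 → ℝ) (i k : Fin 6) :
    (hexRow s i ⬝ᵥ hexCol s k) ^ 2 = hexQ (fun m => s m ^ 2) i k := by
  fin_cases i <;> fin_cases k <;> simp [hexRow, hexCol, hexQ, dotProduct, Fin.sum_univ_four] <;> ring

variable (x : Fin 6 → (Fin 2 → ℝ))

/-- The six slacks under the square roots. [cite: GouveiaRobinsonThomas2015, Thm. 3.4 (p07)] -/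
private def hexSq : Fin 6 → ℝ :=
  ![polygonSlack x 3 0, polygonSlack x 4 0, polygonSlack x 2 5, polygonSlack x 3 5,
    polygonSlack x 1 3, polygonSlack x 5 2]

/-- Row scalings. [cite: GouveiaRobinsonThomas2015, Thm. 3.4 (p07)] -/
private def hexRowScale : Fin 6 → ℝ := ![1, polygonSlack x 0 3, 1, 1, 1, polygonSlack x 0 2]

/-- Column scalings. [cite: GouveiaRobinsonThomas2015, Thm. 3.4 (p07)] -/
private def hexColScale : Fin 6 → ℝ :=
  ![polygonSlack x 2 5 * polygonSlack x 3 0, polygonSlack x 3 0, polygonSlack x 1 3,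
    polygonSlack x 5 2, polygonSlack x 3 5, polygonSlack x 4 0 * polygonSlack x 3 5]

/-- Multiplier of the facet `{x_j, x_{j+1}, x_{j+2}}` in edge `j`. [cite: GouveiaRobinsonThomas2015, Thm. 3.4 (p07)] -/
private def hexLam : Fin 6 → ℝ :=
  ![polygonSlack x 0 2 * polygonSlack x 5 0, polygonSlack x 2 0, polygonSlack x 0 3 * polygonSlack x 3 1,
    polygonSlack x 4 2, polygonSlack x 5 3, polygonSlack x 0 4]

/-- Multiplier of the facet `{x_{j-1}, x_j, x_{j+1}}` in edge `j`. [cite: GouveiaRobinsonThomas2015, Thm. 3.4 (p07)] -/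
private def hexMu : Fin 6 → ℝ :=
  ![polygonSlack x 2 0, polygonSlack x 3 1, polygonSlack x 4 2, polygonSlack x 0 2 * polygonSlack x 5 3,
    polygonSlack x 0 4, polygonSlack x 0 3 * polygonSlack x 5 0]

/-- The projection identities (Grassmann–Plücker): the rescaled hexagon slack is the stated
nonnegative combination of two octahedron facet slacks. [cite: GouveiaRobinsonThomas2015, Thm. 3.4 (p07)] -/
private theorem hexagon_slack_identity (i j : Fin 6) :
    hexRowScale x i * polygonSlack x i j * hexColScale x j =
      hexLam x j * hexQ (hexSq x) i j + hexMu x j * hexQ (hexSq x) i (j + 5) := by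
  fin_cases i <;> fin_cases j <;>
    simp [hexRowScale, hexColScale, hexLam, hexMu, hexQ, hexSq, polygonSlack_apply, Fin.add_def,
      -mul_eq_mul_left_iff, -mul_eq_mul_right_iff, -mul_eq_zero, -zero_eq_mul] <;> ring

/-- `Tr(u uᵀ (λ v vᵀ + μ w wᵀ)) = λ (u·v)² + μ (u·w)²` (rank-one row factor against a rank-two column
factor). [cite: GouveiaRobinsonThomas2013, Ex. 3.6 (iii) (p08)] -/
private theorem trace_vecMulVec_mul_rankTwo (u v w : Fin 4 → ℝ) (l m : ℝ) :
    (vecMulVec u u * (l • vecMulVec v v + m • vecMulVec w w)).trace =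
      l * (u ⬝ᵥ v) ^ 2 + m * (u ⬝ᵥ w) ^ 2 := by
  simp only [Matrix.mul_add, Matrix.mul_smul, trace_add, trace_smul, vecMulVec_mul_vecMulVec,
    trace_vecMulVec, smul_eq_mul, dotProduct_smul]
  ring

/-- **GRT Theorem 3.4, the upper bound — PROVED**: the vertex/edge slack matrix of every convex
hexagon has a psd factorization of size `4`. Printed proof (p07): after an affine normalisation the
hexagon `H` is the image under `π(y₁,y₂,y₃) = (y₁ + a y₃, y₂ + b y₃)` of the octahedron
`O = conv{0, e₁, e₂, e₃, (v₁,0,v₃), (0,w₂,w₃)}`, which is biplanar (planar w.r.t. the `xz`- and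
`yz`-planes), hence has psd rank four by GRT 2013 Thm. 4.8 ("row reduction shows that `√⁺S_O` has rank
four"), and `rank_psd(H) ≤ rank_psd(O)` by Lemma 3.3. Formalised at the level of slack matrices
(recorded deviation, no affine normalisation and no `H`-description of `O` needed): the opposite
vertex pairs of `O` are the diagonals `{x_i, x_{i+3}}` of the hexagon, its facets through hexagon
edges are the consecutive triples `{x_k, x_{k+1}, x_{k+2}}`, and the positive Hadamard square root of
the corresponding `6 × 6` block of `S_O` is the explicit rank-four product `(u_i · v_k)` (`hexRow`,
`hexCol`, entries square roots of six slacks `S₃₀, S₄₀, S₂₅, S₃₅, S₁₃, S₅₂`; `hexRow_dot_hexCol_sq`);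
each hexagon edge functional pulled back to `ℝ³` vanishes on an edge of `O` and is therefore a
nonnegative combination of the two facets of `O` through it (the Lemma 3.3 / projection step, here the
Grassmann–Plücker identities `hexagon_slack_identity` after positive row/column rescaling,
`hasPsdFactorization_rescale_iff`). Row factors `u_i u_iᵀ` (rank one), column factors
`λ_j v_j v_jᵀ + μ_j v_{j−1} v_{j−1}ᵀ` (rank two). [cite: GouveiaRobinsonThomas2015, Thm. 3.4 (p07)] -/
theorem IsConvexPolygon.hasPsdFactorization_four_hexagon {x : Fin 6 → (Fin 2 → ℝ)}
    (hx : IsConvexPolygon x) : HasPsdFactorization (polygonSlack x) 4 := by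
  have hsq : ∀ m, 0 < hexSq x m := by
    intro m
    fin_cases m <;> exact hx _ _ (by decide) (by decide)
  have hc : ∀ i, 0 < hexRowScale x i := by
    intro i
    fin_cases i
    all_goals
      first
        | exact one_pos
        | exact hx _ _ (by decide) (by decide)
  have hd : ∀ j, 0 < hexColScale x j := by
    intro j
    fin_cases j
    all_goals
      first
        | exact hx _ _ (by decide) (by decide)
        | exact mul_pos (hx _ _ (by decide) (by decide)) (hx _ _ (by decide) (by decide))
  have hlam : ∀ j, 0 < hexLam x j := by
    intro j
    fin_cases j
    all_goals
      first
        | exact hx _ _ (by decide) (by decide)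
        | exact mul_pos (hx _ _ (by decide) (by decide)) (hx _ _ (by decide) (by decide))
  have hmu : ∀ j, 0 < hexMu x j := by
    intro j
    fin_cases j
    all_goals
      first
        | exact hx _ _ (by decide) (by decide)
        | exact mul_pos (hx _ _ (by decide) (by decide)) (hx _ _ (by decide) (by decide))
  set s : Fin 6 → ℝ := fun m => Real.sqrt (hexSq x m) with hs_def
  have hs : (fun m => s m ^ 2) = hexSq x := funext fun m => Real.sq_sqrt (hsq m).le
  have hfac : HasPsdFactorization
      (fun i j => hexRowScale x i * polygonSlack x i j * hexColScale x j) 4 := by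
    refine ⟨fun i => vecMulVec (hexRow s i) (hexRow s i),
      fun j => hexLam x j • vecMulVec (hexCol s j) (hexCol s j) +
        hexMu x j • vecMulVec (hexCol s (j + 5)) (hexCol s (j + 5)),
      fun i => ?_, fun j => ?_, fun i j => ?_⟩
    · simpa using posSemidef_vecMulVec_self_star (hexRow s i)
    · exact PosSemidef.add
        (PosSemidef.smul (by simpa using posSemidef_vecMulVec_self_star (hexCol s j)) (hlam j).le)
        (PosSemidef.smul (by simpa using posSemidef_vecMulVec_self_star (hexCol s (j + 5))) (hmu j).le)
    · rw [trace_vecMulVec_mul_rankTwo, hexRow_dot_hexCol_sq, hexRow_dot_hexCol_sq, hs]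
      exact hexagon_slack_identity x i j
  exact (hasPsdFactorization_rescale_iff (M := polygonSlack x) hc hd).mp hfac

/-- **GRT Theorem 3.4 DISCHARGED**: the named fact `GouveiaRobinsonThomas2015_thm34` holds.
[cite: GouveiaRobinsonThomas2015, Thm. 3.4 (p07)] -/
theorem GouveiaRobinsonThomas2015_thm34_holds : GouveiaRobinsonThomas2015_thm34 :=
  fun _ hx => hx.hasPsdFactorization_four_hexagon

/-- **GRT Theorem 3.4** (p07, verbatim): "Every hexagon has psd rank exactly four" — unconditionally:
size `4` is attained and size `3` is not (GRT 2013 Thm. 4.7). [cite: GouveiaRobinsonThomas2015, Thm. 3.4 (p07)] -/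
theorem IsConvexPolygon.psdRank_hexagon {x : Fin 6 → (Fin 2 → ℝ)} (hx : IsConvexPolygon x) :
    HasPsdFactorization (polygonSlack x) 4 ∧ ¬ HasPsdFactorization (polygonSlack x) 3 :=
  GouveiaRobinsonThomas2015_thm34.exact GouveiaRobinsonThomas2015_thm34_holds hx

/-- Theorem 3.4 as a statement on psd LIFTS (with FGPRT Thm. 3.3, `IsConvexPolygon.hasPsdLift_iff`):
every convex hexagon is a linear image of an affine slice of `S^4_+`, and of no smaller psd cone
("`rank_psd(H) = 4`"). [cite: GouveiaRobinsonThomas2015, Thm. 3.4 (p07)] -/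
theorem GouveiaRobinsonThomas2015_thm34_lift {x : Fin 6 → (Fin 2 → ℝ)} (hx : IsConvexPolygon x) :
    HasPsdLift (convexHull ℝ (Set.range x)) 4 ∧
      ∀ k, HasPsdLift (convexHull ℝ (Set.range x)) k → 4 ≤ k :=
  ⟨(hx.hasPsdLift_iff (by norm_num) (by norm_num)).mpr hx.hasPsdFactorization_four_hexagon,
    fun _ hk => hx.four_le_of_hasPsdLift (by norm_num) hk⟩

/-- **The p07 remark, now unconditional** ("all `7`-gons have psd rank either four or five by Theorem
3.4, Lemma 3.1 …"): every convex `m`-gon with `m ≥ 6` has a psd factorization of size `m − 2`.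
[cite: GouveiaRobinsonThomas2015, §3 (p07)] -/
theorem IsConvexPolygon.hasPsdFactorization_sub_two {m : ℕ} [NeZero m] {x : Fin m → (Fin 2 → ℝ)}
    (hx : IsConvexPolygon x) (hm : 6 ≤ m) : HasPsdFactorization (polygonSlack x) (m - 2) :=
  GouveiaRobinsonThomas2015_thm34.hasPsdFactorization_sub_two GouveiaRobinsonThomas2015_thm34_holds
    m x hx hm

/-- **Heptagons** (p07: "all `7`-gons have psd rank either four or five"): every convex heptagon has
a psd factorization of size `5` and none of size `3`. [cite: GouveiaRobinsonThomas2015, §3 (p07)] -/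
theorem IsConvexPolygon.psdRank_heptagon_bounds {x : Fin 7 → (Fin 2 → ℝ)} (hx : IsConvexPolygon x) :
    HasPsdFactorization (polygonSlack x) 5 ∧ ¬ HasPsdFactorization (polygonSlack x) 3 :=
  ⟨hx.hasPsdFactorization_sub_two (by norm_num), hx.not_hasPsdFactorization_three (by norm_num)⟩

end Hexagon

/-! ### Theorem 3.7, polygon clause PROVED: every convex `m`-gon has psd rank `≤ 4⌈m/6⌉`

Printed proof (p07): a nonnegative rank-three matrix with six rows is the generalized slack matrix
`S_{P,Q}` of six points `P` inside a polygon `Q` (Def. 3.5); `rank_psd(S_{P,Q}) ≤ rank_psd(P) ≤ 4`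
(Prop. 3.6, Thm. 3.4); a general rank-three matrix is the concatenation of `⌈q/6⌉` such blocks and
psd ranks add under concatenation (block-diagonal factors). For the "in particular" clause (the
slack matrix of a convex `m`-gon) this is carried out here with the six points in convex position:
the `m × 6` block of six consecutive edge columns is, after dehomogenising at the vertex centroid
`o` (`S_{ij} = c_j (1 + w_j · (x_i − o))`, `c_j = (1/m)Σ_i S_{ij} > 0`, `w_j = n_j / c_j` the POLAR
vertex of edge `j`), the generalized slack matrix of six consecutive vertices of the polar polygon
(a convex hexagon: `isConvexPolygon_polarVertex`, `IsConvexPolygon.hexagonAt`) against the `m` valid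
functionals `w ↦ 1 + (x_i − o) · w`; Prop. 3.6 at matrix level is
`IsConvexPolygon.hasPsdFactorization_of_valid` (a valid affine functional on a convex polygon is, on
the vertices, `min ≥ 0` times the normalised all-ones column — row sums of the slack matrix are the
constant `Σ_j det(x_j, x_{j+1})` — plus a nonnegative combination of the two edges at a minimising
vertex: `IsConvexPolygon.exists_edgeCoeffs_of_valid`), and concatenation is FGPRT Thm. 2.9 (iii). -/

section ValidInequalities

variable {m : ℕ} [NeZero m]

/-- Twice the signed area of the vertex list (shoelace sum `Σ_j det(x_j, x_{j+1})`). [folklore] -/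
def polygonArea2 (x : Fin m → (Fin 2 → ℝ)) : ℝ := ∑ j, cross2 (x j) (x (j + 1))

/-- **Row sums of the slack matrix are constant** (`Σ_j S_{ij} = Σ_j det(x_j, x_{j+1})`, the edge
vectors of a closed polygon sum to zero): the all-ones column is a positive combination of the facet
columns. [cite: GouveiaRobinsonThomas2015, Def. 3.5 / Prop. 3.6 (p06–07)] -/
theorem sum_polygonSlack_row (x : Fin m → (Fin 2 → ℝ)) (i : Fin m) :
    ∑ j, polygonSlack x i j = polygonArea2 x := by
  have h1 : ∀ j, polygonSlack x i j =
      (cross2 (x (j + 1)) (x i) - cross2 (x j) (x i)) + cross2 (x j) (x (j + 1)) := by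
    intro j
    simp only [polygonSlack_apply, cross2]
    ring
  simp_rw [h1, Finset.sum_add_distrib, Finset.sum_sub_distrib]
  have h2 : ∑ j, cross2 (x (j + 1)) (x i) = ∑ j, cross2 (x j) (x i) :=
    Fintype.sum_equiv (Equiv.addRight 1) _ _ (fun j => rfl)
  rw [h2, sub_self, zero_add, polygonArea2]

/-- A convex polygon (`m ≥ 3`) has positive area: `Σ_j det(x_j, x_{j+1}) > 0`.
[cite: GouveiaRobinsonThomas2013, Thm. 4.7 (p11, "convex polygon")] -/
theorem IsConvexPolygon.polygonArea2_pos {x : Fin m → (Fin 2 → ℝ)} (hx : IsConvexPolygon x)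
    (hm : 3 ≤ m) : 0 < polygonArea2 x := by
  rw [← sum_polygonSlack_row x 0]
  have h01 : (0 : Fin m) ≠ 1 := by
    intro h
    have := congrArg Fin.val h
    rw [Fin.val_zero, Fin.val_one', Nat.mod_eq_of_lt (by omega)] at this
    omega
  have h02 : (0 : Fin m) ≠ 1 + 1 := by
    intro h
    have := congrArg Fin.val h
    rw [Fin.val_zero, Fin.val_add, Fin.val_one', Nat.mod_eq_of_lt (show 1 < m by omega),
      Nat.mod_eq_of_lt (show 1 + 1 < m by omega)] at this
    omega
  calc (0 : ℝ) < polygonSlack x 0 1 := hx 0 1 h01 h02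
    _ ≤ ∑ j, polygonSlack x 0 j :=
        Finset.single_le_sum (f := fun j => polygonSlack x 0 j) (fun j _ => hx.nonneg 0 j)
          (Finset.mem_univ 1)

/-- Lagrange's identity in the plane: `det(u,u') (g·z) = (g·u') det(u,z) − (g·u) det(u',z)`. [folklore] -/
private theorem dot_mul_cross2_expand (g u u' z : Fin 2 → ℝ) :
    cross2 u u' * (g ⬝ᵥ z) = (g ⬝ᵥ u') * cross2 u z - (g ⬝ᵥ u) * cross2 u' z := by
  simp only [cross2, dotProduct, Fin.sum_univ_two]
  ring

/-- In `Fin m` with `m ≥ 3`: `a + 1 ≠ a - 1`. [folklore] -/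
private theorem add_one_ne_sub_one (hm : 3 ≤ m) (a : Fin m) : a + 1 ≠ a - 1 := by
  intro h
  have h2 : (a - 1) + 1 + 1 = a - 1 := by rw [sub_add_cancel, h]
  have h3 : ((1 : Fin m) + 1) = 0 := by
    have := congrArg (fun t => t - (a - 1)) h2
    simpa [add_sub_cancel_left, add_assoc] using this
  have := congrArg Fin.val h3
  rw [Fin.val_add, Fin.val_one', Fin.val_zero, Nat.mod_eq_of_lt (show 1 < m by omega),
    Nat.mod_eq_of_lt (show 1 + 1 < m by omega)] at this
  omega

/-- In `Fin m` with `m ≥ 2`: `a + 1 ≠ a`. [folklore] -/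
private theorem add_one_ne_self (hm : 2 ≤ m) (a : Fin m) : a + 1 ≠ a := by
  intro h
  have h3 : (1 : Fin m) = 0 := by simpa using congrArg (fun t => t - a) h
  have := congrArg Fin.val h3
  rw [Fin.val_one', Fin.val_zero, Nat.mod_eq_of_lt (show 1 < m by omega)] at this
  omega

/-- **Valid inequalities of a convex polygon are nonnegative combinations of its edge inequalities,
on the vertices** (the Farkas / LP-duality step behind Prop. 3.6: an affine functional `L ≥ 0` on the
vertices equals `min_j L(x_j) ≥ 0` times the normalised all-ones column plus a nonnegative
combination of the two edges at a minimising vertex). [cite: GouveiaRobinsonThomas2015, Prop. 3.6 (p07)] -/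
theorem IsConvexPolygon.exists_edgeCoeffs_of_valid {x : Fin m → (Fin 2 → ℝ)} (hx : IsConvexPolygon x)
    (hm : 3 ≤ m) (g : Fin 2 → ℝ) (c : ℝ) (hL : ∀ j, 0 ≤ g ⬝ᵥ x j + c) :
    ∃ ν : Fin m → ℝ, (∀ e, 0 ≤ ν e) ∧ ∀ j, g ⬝ᵥ x j + c = ∑ e, ν e * polygonSlack x j e := by
  obtain ⟨a, -, ha⟩ := Finset.exists_min_image Finset.univ (fun j => g ⬝ᵥ x j + c) Finset.univ_nonempty
  have hA := hx.polygonArea2_pos hm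
  have hne1 : a + 1 ≠ a - 1 := add_one_ne_sub_one hm a
  have hne2 : a + 1 ≠ a - 1 + 1 := by rw [sub_add_cancel]; exact add_one_ne_self (by omega) a
  have hne3 : a - 1 ≠ a := by
    intro h; exact add_one_ne_self (by omega) (a - 1) (by rw [sub_add_cancel]; exact h.symm)
  have hne4 : a - 1 ≠ a + 1 := fun h => hne1 h.symm
  have hD1 : 0 < polygonSlack x (a + 1) (a - 1) := hx _ _ hne1 hne2
  have hD2 : 0 < polygonSlack x (a - 1) a := hx _ _ hne3 hne4
  set μ0 := g ⬝ᵥ x a + c with hμ0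
  set α := (g ⬝ᵥ x (a + 1) + c - μ0) / polygonSlack x (a + 1) (a - 1) with hα
  set β := (g ⬝ᵥ x (a - 1) + c - μ0) / polygonSlack x (a - 1) a with hβ
  have hμ0nn : 0 ≤ μ0 := hL a
  have hαnn : 0 ≤ α := div_nonneg (sub_nonneg.mpr (ha _ (Finset.mem_univ _))) hD1.le
  have hβnn : 0 ≤ β := div_nonneg (sub_nonneg.mpr (ha _ (Finset.mem_univ _))) hD2.le
  refine ⟨fun e => μ0 / polygonArea2 x + ((if e = a - 1 then α else 0) + (if e = a then β else 0)),
    fun e => ?_, fun j => ?_⟩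
  · refine add_nonneg (div_nonneg hμ0nn hA.le) (add_nonneg ?_ ?_) <;> split_ifs <;>
      first | exact le_rfl | assumption
  · simp_rw [add_mul, Finset.sum_add_distrib, ite_mul, zero_mul, Finset.sum_ite_eq', Finset.mem_univ,
      if_true, ← Finset.mul_sum, sum_polygonSlack_row, div_mul_cancel₀ _ hA.ne']
    -- the geometric identity: L(x_j) - μ0 = α S(j, a-1) + β S(j, a)
    have key : polygonSlack x (a + 1) (a - 1) * polygonSlack x (a - 1) a * (g ⬝ᵥ x j + c - μ0) =
        polygonSlack x (a - 1) a * (g ⬝ᵥ x (a + 1) + c - μ0) * polygonSlack x j (a - 1) +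
        polygonSlack x (a + 1) (a - 1) * (g ⬝ᵥ x (a - 1) + c - μ0) * polygonSlack x j a := by
      simp only [hμ0, polygonSlack_apply, sub_add_cancel, dotProduct, Fin.sum_univ_two]
      ring
    rw [hα, hβ]
    field_simp
    linear_combination key

/-- **GRT Proposition 3.6 (the inequality `rank_psd(S_{P,Q}) ≤ rank_psd(P)`) at the level of slack
matrices, for polygons**: if the vertex/edge slack matrix of a convex polygon `P` has a psd
factorization of size `k`, then so does every generalized slack matrix `(L_t(x_j))_{j,t}` of `P`
against affine functionals `L_t(y) = g_t·y + c_t` valid (nonnegative) on the vertices of `P` — each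
column is a nonnegative combination of edge columns (`IsConvexPolygon.exists_edgeCoeffs_of_valid`,
FGPRT Thm. 2.9 (iv) `HasPsdFactorization.mulRight`). [cite: GouveiaRobinsonThomas2015, Prop. 3.6 (p07)] -/
theorem IsConvexPolygon.hasPsdFactorization_of_valid {x : Fin m → (Fin 2 → ℝ)}
    (hx : IsConvexPolygon x) (hm : 3 ≤ m) {k : ℕ} (hk : HasPsdFactorization (polygonSlack x) k)
    {ι : Type*} (g : ι → Fin 2 → ℝ) (c : ι → ℝ) (hL : ∀ t j, 0 ≤ g t ⬝ᵥ x j + c t) :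
    HasPsdFactorization (fun j t => g t ⬝ᵥ x j + c t) k := by
  choose ν hν hL' using fun t => hx.exists_edgeCoeffs_of_valid hm (g t) (c t) (hL t)
  have h := hk.mulRight (N := fun e t => ν t e) (fun e t => hν t e)
  have hfun : (fun j t => g t ⬝ᵥ x j + c t) =
      fun j t => ∑ e, polygonSlack x j e * (fun e t => ν t e) e t := by
    funext j t
    rw [hL' t j]
    exact Finset.sum_congr rfl fun e _ => mul_comm _ _
  rw [hfun]
  exact h

end ValidInequalities

/-! ### The polar polygon about the vertex centroid -/

section Polar

variable {m : ℕ} [NeZero m]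

/-- The slack of the vertex centroid in edge `j`: `c_j = (1/m) Σ_i S_{ij}`. [folklore] -/
def slackCenter (x : Fin m → (Fin 2 → ℝ)) (j : Fin m) : ℝ := (∑ i, polygonSlack x i j) / m

/-- The inner edge normal `n_j = rot(x_{j+1} − x_j)`, so that `S_{ij} = n_j · (x_i − x_j)`. [folklore] -/
def edgeNormal (x : Fin m → (Fin 2 → ℝ)) (j : Fin m) : Fin 2 → ℝ :=
  ![-(x (j + 1) 1 - x j 1), x (j + 1) 0 - x j 0]

/-- The vertex centroid `o = (1/m) Σ_i x_i`. [folklore] -/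
def vertexCentroid (x : Fin m → (Fin 2 → ℝ)) : Fin 2 → ℝ := ((m : ℝ)⁻¹) • ∑ i, x i

/-- **The polar polygon** about the vertex centroid: `w_j = n_j / c_j`, the vertex of
`(P − o)° = {w : 1 + w·(y − o) ≥ 0 ∀ y ∈ P}` dual to the edge `j` (psd rank is invariant under
polarity; here only the slack-matrix identity `S_{ij} = c_j (1 + w_j·(x_i − o))` is used).
[cite: GouveiaRobinsonThomas2013, §4 (p12, "psd rank is preserved under polarity")] -/
def polarVertex (x : Fin m → (Fin 2 → ℝ)) (j : Fin m) : Fin 2 → ℝ :=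
  (slackCenter x j)⁻¹ • edgeNormal x j

/-- `S_{ij} = n_j · (x_i − x_j)` (the slack matrix factors through the facet normals and the
vertices, GRT 2013 Lemma 3.1). [cite: GouveiaRobinsonThomas2013, Lemma 3.1 (p07)] -/
theorem polygonSlack_eq_edgeNormal_dot (x : Fin m → (Fin 2 → ℝ)) (i j : Fin m) :
    polygonSlack x i j = edgeNormal x j ⬝ᵥ (x i - x j) := by
  simp only [polygonSlack_apply, edgeNormal, dotProduct, Fin.sum_univ_two, Matrix.cons_val_zero,
    Matrix.cons_val_one, Pi.sub_apply]
  ring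

/-- `c_j = n_j · (o − x_j)`: the centroid's slack is the average vertex slack (affine
functionals commute with averaging; the entry `d_j − c_jᵀp` of Def. 3.5 at `p = o`).
[cite: GouveiaRobinsonThomas2015, Def. 3.5 (p06)] -/
theorem slackCenter_eq (x : Fin m → (Fin 2 → ℝ)) (j : Fin m) :
    slackCenter x j = edgeNormal x j ⬝ᵥ (vertexCentroid x - x j) := by
  have hm : (m : ℝ) ≠ 0 := Nat.cast_ne_zero.mpr (NeZero.ne m)
  have h1 : ∑ i, polygonSlack x i j =
      edgeNormal x j 0 * (∑ i, x i 0 - m * x j 0) + edgeNormal x j 1 * (∑ i, x i 1 - m * x j 1) := by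
    simp_rw [polygonSlack_eq_edgeNormal_dot, dotProduct, Fin.sum_univ_two, Pi.sub_apply]
    rw [Finset.sum_add_distrib, ← Finset.mul_sum, ← Finset.mul_sum, Finset.sum_sub_distrib,
      Finset.sum_sub_distrib]
    simp [Finset.sum_const, Finset.card_univ, Fintype.card_fin, nsmul_eq_mul]
  have h2 : ∀ l, vertexCentroid x l = ((m : ℝ)⁻¹) * ∑ i, x i l := by
    intro l
    simp [vertexCentroid, Finset.sum_apply, smul_eq_mul]
  rw [slackCenter, h1, dotProduct, Fin.sum_univ_two, Pi.sub_apply, Pi.sub_apply, h2, h2]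
  field_simp

/-- The centroid of a convex polygon (`m ≥ 3`) lies strictly inside every edge: `c_j > 0`.
[cite: GouveiaRobinsonThomas2013, Thm. 4.7 (p11, "convex polygon")] -/
theorem IsConvexPolygon.slackCenter_pos {x : Fin m → (Fin 2 → ℝ)} (hx : IsConvexPolygon x)
    (hm : 3 ≤ m) (j : Fin m) : 0 < slackCenter x j := by
  have hmpos : (0 : ℝ) < m := Nat.cast_pos.mpr (Nat.pos_of_ne_zero (NeZero.ne m))
  refine div_pos ?_ hmpos
  have hne1 : j + 1 + 1 ≠ j := by
    intro h
    have h2 : (1 : Fin m) + 1 = 0 := by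
      have := congrArg (fun t => t - j) h
      simpa [add_assoc, add_sub_cancel_left] using this
    have := congrArg Fin.val h2
    rw [Fin.val_add, Fin.val_one', Fin.val_zero, Nat.mod_eq_of_lt (show 1 < m by omega),
      Nat.mod_eq_of_lt (show 1 + 1 < m by omega)] at this
    omega
  have hne2 : j + 1 + 1 ≠ j + 1 := by
    intro h
    have h2 : (1 : Fin m) = 0 := by simpa using congrArg (fun t => t - (j + 1)) h
    have := congrArg Fin.val h2
    rw [Fin.val_one', Fin.val_zero, Nat.mod_eq_of_lt (show 1 < m by omega)] at this
    omega
  calc (0 : ℝ) < polygonSlack x (j + 1 + 1) j := hx _ _ hne1 hne2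
    _ ≤ ∑ i, polygonSlack x i j :=
        Finset.single_le_sum (f := fun i => polygonSlack x i j) (fun i _ => hx.nonneg i j)
          (Finset.mem_univ _)

/-- **The slack matrix through the polar polygon**: `S_{ij} = c_j (1 + w_j · (x_i − o))` — the
generalized slack matrix of the points `w_j` against the affine functionals `w ↦ 1 + (x_i − o)·w`,
row/column-rescaled. [cite: GouveiaRobinsonThomas2015, Prop. 3.6 (p07)] -/
theorem polygonSlack_eq_slackCenter_mul {x : Fin m → (Fin 2 → ℝ)} (hc : ∀ j, slackCenter x j ≠ 0)
    (i j : Fin m) :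
    polygonSlack x i j =
      slackCenter x j * ((x i - vertexCentroid x) ⬝ᵥ polarVertex x j + 1) := by
  rw [polarVertex, dotProduct_smul, smul_eq_mul, mul_add, ← mul_assoc, mul_inv_cancel₀ (hc j),
    one_mul, mul_one, dotProduct_comm, slackCenter_eq, ← dotProduct_add,
    polygonSlack_eq_edgeNormal_dot]
  congr 1
  abel

/-- Determinant expansion behind the polar slack formula: for the normals `n_j, n_{j+1}, n_k`,
centroid slacks `c = n·(o − x)` and any `z`, `c_j[n_{j+1},n_k] + c_k[n_j,n_{j+1}] − c_{j+1}[n_j,n_k]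
= [n_j,n_{j+1}] S_{j+1,k}` (pure algebra). [folklore] -/
private theorem polar_det_identity (x : Fin m → (Fin 2 → ℝ)) (o : Fin 2 → ℝ) (j k : Fin m) :
    (edgeNormal x j ⬝ᵥ (o - x j)) * cross2 (edgeNormal x (j + 1)) (edgeNormal x k) +
      (edgeNormal x k ⬝ᵥ (o - x k)) * cross2 (edgeNormal x j) (edgeNormal x (j + 1)) -
      (edgeNormal x (j + 1) ⬝ᵥ (o - x (j + 1))) * cross2 (edgeNormal x j) (edgeNormal x k) =
    cross2 (edgeNormal x j) (edgeNormal x (j + 1)) * polygonSlack x (j + 1) k := by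
  simp only [edgeNormal, cross2, dotProduct, Fin.sum_univ_two, Matrix.cons_val_zero,
    Matrix.cons_val_one, Pi.sub_apply, polygonSlack_apply]
  ring

/-- `[n_j, n_{j+1}] = S_{j+2,j}` (rotation preserves determinants). [folklore] -/
private theorem cross2_edgeNormal_succ (x : Fin m → (Fin 2 → ℝ)) (j : Fin m) :
    cross2 (edgeNormal x j) (edgeNormal x (j + 1)) = polygonSlack x (j + 1 + 1) j := by
  simp only [edgeNormal, cross2, Matrix.cons_val_zero, Matrix.cons_val_one, polygonSlack_apply]
  ring

/-- **Slack matrix of the polar polygon**: `c_j c_{j+1} c_k · S^w_{kj} = S_{j+2,j} S_{j+1,k}` (the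
`3 × 3` determinant of the three edge functionals, two of which meet at the vertex `x_{j+1}`).
[cite: GouveiaRobinsonThomas2013, §4 (p12, polarity)] -/
theorem slackCenter_mul_polygonSlack_polarVertex {x : Fin m → (Fin 2 → ℝ)}
    (hc : ∀ j, slackCenter x j ≠ 0) (k j : Fin m) :
    slackCenter x j * slackCenter x (j + 1) * slackCenter x k * polygonSlack (polarVertex x) k j =
      polygonSlack x (j + 1 + 1) j * polygonSlack x (j + 1) k := by
  have hj := hc j
  have hj1 := hc (j + 1)
  have hk := hc k
  have key := polar_det_identity x (vertexCentroid x) j k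
  rw [← slackCenter_eq, ← slackCenter_eq, ← slackCenter_eq, cross2_edgeNormal_succ] at key
  rw [← key]
  simp only [polygonSlack_apply, polarVertex, Pi.smul_apply, smul_eq_mul, cross2, edgeNormal,
    Matrix.cons_val_zero, Matrix.cons_val_one]
  field_simp
  ring

/-- **The polar of a convex polygon is a convex polygon** (same cyclic order).
[cite: GouveiaRobinsonThomas2013, §4 (p12, polarity)] -/
theorem isConvexPolygon_polarVertex {x : Fin m → (Fin 2 → ℝ)} (hx : IsConvexPolygon x)
    (hm : 3 ≤ m) : IsConvexPolygon (polarVertex x) := by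
  intro k j hkj hkj1
  have hc : ∀ j, slackCenter x j ≠ 0 := fun j => (hx.slackCenter_pos hm j).ne'
  have h := slackCenter_mul_polygonSlack_polarVertex hc k j
  have hpos : 0 < polygonSlack x (j + 1 + 1) j * polygonSlack x (j + 1) k := by
    refine mul_pos (hx _ _ ?_ ?_) (hx _ _ (Ne.symm hkj1) ?_)
    · intro h'
      have h2 : (1 : Fin m) + 1 = 0 := by
        have := congrArg (fun t => t - j) h'
        simpa [add_assoc, add_sub_cancel_left] using this
      have := congrArg Fin.val h2
      rw [Fin.val_add, Fin.val_one', Fin.val_zero, Nat.mod_eq_of_lt (show 1 < m by omega),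
        Nat.mod_eq_of_lt (show 1 + 1 < m by omega)] at this
      omega
    · intro h'
      have h2 : (1 : Fin m) = 0 := by simpa using congrArg (fun t => t - (j + 1)) h'
      have := congrArg Fin.val h2
      rw [Fin.val_one', Fin.val_zero, Nat.mod_eq_of_lt (show 1 < m by omega)] at this
      omega
    · intro h'
      exact hkj (add_right_cancel h').symm
  have hcpos : 0 < slackCenter x j * slackCenter x (j + 1) * slackCenter x k :=
    mul_pos (mul_pos (hx.slackCenter_pos hm _) (hx.slackCenter_pos hm _)) (hx.slackCenter_pos hm _)
  rw [← h] at hpos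
  exact pos_of_mul_pos_right hpos hcpos.le

end Polar

/-! ### Consecutive sub-polygons and the `4⌈v/6⌉` bound (Theorem 3.7, polygon clause) -/

section SubPolygon

variable {M : ℕ} [NeZero M]

/-- **The first `n ≥ 3` vertices of a convex polygon form a convex polygon** (drop the last vertex
repeatedly, `isConvexPolygon_dropVertex`). [cite: GouveiaRobinsonThomas2015, Lemma 3.1 (p06)] -/
theorem IsConvexPolygon.takeFirst {n : ℕ} [NeZero n] (hn : 3 ≤ n) :
    ∀ (M : ℕ) (h : n ≤ M) [NeZero M] (x : Fin M → (Fin 2 → ℝ)), IsConvexPolygon x →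
      IsConvexPolygon (fun k : Fin n => x (Fin.castLE h k)) := by
  refine Nat.le_induction ?_ ?_
  · intro _ x hx
    simp_rw [Fin.castLE_refl]
    exact hx
  · intro M hnM ih _ x hx
    haveI : NeZero M := ⟨by omega⟩
    have hd := isConvexPolygon_dropVertex hx (by omega)
    have h' := ih (dropVertex x) hd
    have hfun : (fun k : Fin n => x (Fin.castLE (Nat.le_succ_of_le hnM) k)) =
        fun k : Fin n => dropVertex x (Fin.castLE hnM k) := by
      funext k
      simp only [dropVertex]
      congr 1
    rw [hfun]
    exact h'

/-- Six consecutive vertices `x_a, …, x_{a+5}` of a convex polygon (`M ≥ 6`) form a convex hexagon.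
[cite: GouveiaRobinsonThomas2015, Lemma 3.1 (p06)] -/
theorem IsConvexPolygon.hexagonAt {x : Fin M → (Fin 2 → ℝ)} (hx : IsConvexPolygon x) (hM : 6 ≤ M)
    (a : Fin M) : IsConvexPolygon (fun k : Fin 6 => x (a + Fin.castLE hM k)) :=
  IsConvexPolygon.takeFirst (n := 6) (by norm_num) M hM (fun i => x (a + i)) (hx.rotate a)

end SubPolygon

section PolygonClause

variable {m : ℕ} [NeZero m]

/-- **One block of six consecutive edges has psd rank `≤ 4`**: for a convex `m`-gon (`m ≥ 6`) and a
base edge `a`, the `m × 6` block `(S_{i, a+k})_{i, k<6}` of the slack matrix has an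
`S^4_+`-factorization — it is, up to positive column scaling, the generalized slack matrix of the
polar hexagon `w_a, …, w_{a+5}` against the `m` valid functionals `w ↦ 1 + (x_i − o)·w`
(Prop. 3.6 + Thm. 3.4: "a `6 × q` nonnegative matrix of rank three is the generalized slack matrix of
a hexagon inside a `q`-gon and so has psd rank at most four", here with the six points in convex
position). [cite: GouveiaRobinsonThomas2015, Thm. 3.7 (p07)] -/
theorem IsConvexPolygon.hasPsdFactorization_four_block {x : Fin m → (Fin 2 → ℝ)}
    (hx : IsConvexPolygon x) (hm : 6 ≤ m) (a : Fin m) :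
    HasPsdFactorization (fun i (k : Fin 6) => polygonSlack x i (a + Fin.castLE hm k)) 4 := by
  have hc : ∀ j, 0 < slackCenter x j := fun j => hx.slackCenter_pos (by omega) j
  have hc' : ∀ j, slackCenter x j ≠ 0 := fun j => (hc j).ne'
  have hw : IsConvexPolygon (polarVertex x) := isConvexPolygon_polarVertex hx (by omega)
  have hH : IsConvexPolygon (fun k : Fin 6 => polarVertex x (a + Fin.castLE hm k)) := hw.hexagonAt hm a
  have hL : ∀ (i : Fin m) (k : Fin 6),
      0 ≤ (x i - vertexCentroid x) ⬝ᵥ polarVertex x (a + Fin.castLE hm k) + 1 := by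
    intro i k
    have h := polygonSlack_eq_slackCenter_mul hc' i (a + Fin.castLE hm k)
    have hnn := hx.nonneg i (a + Fin.castLE hm k)
    rw [h] at hnn
    exact nonneg_of_mul_nonneg_right hnn (hc _)
  have h4 := hH.hasPsdFactorization_of_valid (by norm_num) hH.hasPsdFactorization_four_hexagon
    (fun i => x i - vertexCentroid x) (fun _ => (1 : ℝ)) hL
  have h5 := (h4.transpose).rescale (c := fun _ => (1 : ℝ))
    (d := fun k => slackCenter x (a + Fin.castLE hm k)) (fun _ => zero_le_one) (fun k => (hc _).le)
  have hfun : (fun i (k : Fin 6) => polygonSlack x i (a + Fin.castLE hm k)) =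
      fun i k => 1 * ((x i - vertexCentroid x) ⬝ᵥ polarVertex x (a + Fin.castLE hm k) + 1) *
        slackCenter x (a + Fin.castLE hm k) := by
    funext i k
    rw [polygonSlack_eq_slackCenter_mul hc' i, one_mul, mul_comm]
  rw [hfun]
  exact h5

/-- Base edge of the `b`-th block of six consecutive edges (the last block is pulled back so that it
still consists of six edges). [cite: GouveiaRobinsonThomas2015, Thm. 3.7 (p07, "concatenation")] -/
private def blockBase (m b : ℕ) : ℕ := min (6 * b) (m - 6)

/-- The block containing edge `j` covers it. [folklore] -/
private theorem blockBase_le_of_div {m j : ℕ} (hj : j < m) (hm : 6 ≤ m) :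
    blockBase m (j / 6) ≤ j ∧ j < blockBase m (j / 6) + 6 := by
  unfold blockBase
  omega

/-- **The blocks `{j : ⌊j/6⌋ = b}` of the slack matrix have psd rank `≤ 4`** (a column subset of a
block of six consecutive edges, other columns zero). [cite: GouveiaRobinsonThomas2015, Thm. 3.7 (p07)] -/
private theorem IsConvexPolygon.hasPsdFactorization_four_blockIdx {x : Fin m → (Fin 2 → ℝ)}
    (hx : IsConvexPolygon x) (hm : 6 ≤ m) (b : ℕ) :
    HasPsdFactorization (fun i j => if j.val / 6 = b then polygonSlack x i j else 0) 4 := by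
  have hbase : blockBase m b < m := by unfold blockBase; omega
  set a : Fin m := ⟨blockBase m b, hbase⟩ with ha
  let off : Fin m → Fin 6 := fun j => ⟨(j.val - blockBase m b) % 6, Nat.mod_lt _ (by norm_num)⟩
  have h1 := (hx.hasPsdFactorization_four_block hm a).submatrix id off
  have h2 := h1.rescale (c := fun _ => (1 : ℝ)) (d := fun j : Fin m => if j.val / 6 = b then (1 : ℝ) else 0)
    (fun _ => zero_le_one) (fun j => by split_ifs <;> norm_num)
  have hfun : (fun i j => if j.val / 6 = b then polygonSlack x i j else 0) =
      fun i j => 1 * polygonSlack x (id i) (a + Fin.castLE hm (off j)) *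
        (if j.val / 6 = b then (1 : ℝ) else 0) := by
    funext i j
    split_ifs with hj
    · have hcov := blockBase_le_of_div j.isLt hm
      rw [hj] at hcov
      have hidx : a + Fin.castLE hm (off j) = j := by
        apply Fin.ext
        rw [Fin.val_add, Fin.val_castLE]
        change (blockBase m b + (j.val - blockBase m b) % 6) % m = j.val
        rw [Nat.mod_eq_of_lt (show j.val - blockBase m b < 6 by omega),
          Nat.add_sub_cancel' hcov.1, Nat.mod_eq_of_lt j.isLt]
      rw [hidx, id, one_mul, mul_one]
    · rw [mul_zero]
  rw [hfun]
  exact h2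

/-- Partial sums of the blocks: the columns `{j : ⌊j/6⌋ < n}` have psd rank `≤ 4n`.
[cite: GouveiaRobinsonThomas2015, Thm. 3.7 (p07, "concatenation of ⌈q/6⌉ matrices")] -/
private theorem IsConvexPolygon.hasPsdFactorization_blocks_lt {x : Fin m → (Fin 2 → ℝ)}
    (hx : IsConvexPolygon x) (hm : 6 ≤ m) (n : ℕ) :
    HasPsdFactorization (fun i j => if j.val / 6 < n then polygonSlack x i j else 0) (4 * n) := by
  induction n with
  | zero =>
    rw [Nat.mul_zero]
    exact hasPsdFactorization_zero_iff.mpr (fun i j => by simp)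
  | succ n ih =>
    have h := ih.add (hx.hasPsdFactorization_four_blockIdx hm n)
    have hfun : (fun i j => if j.val / 6 < n + 1 then polygonSlack x i j else 0) =
        fun i j => (if j.val / 6 < n then polygonSlack x i j else 0) +
          (if j.val / 6 = n then polygonSlack x i j else 0) := by
      funext i j
      by_cases h1 : j.val / 6 < n
      · rw [if_pos (by omega), if_pos h1, if_neg (by omega), add_zero]
      · by_cases h2 : j.val / 6 = n
        · rw [if_pos (by omega), if_neg h1, if_pos h2, zero_add]
        · rw [if_neg (by omega), if_neg h1, if_neg h2, add_zero]
    rw [hfun, show 4 * (n + 1) = 4 * n + 4 by ring]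
    exact h

/-- **GRT Theorem 3.7, polygon clause — PROVED** (p07, verbatim): "In particular, the psd rank of
a `v`-gon is at most `4⌈v/6⌉`." For every convex `m`-gon (`m ≥ 3`) the vertex/edge slack matrix
has a psd factorization of size `4⌈m/6⌉ = 4((m+5)/6)`. Printed proof: write the slack matrix as
the concatenation of `⌈m/6⌉` blocks of at most six columns; a block is (the transpose of) a
nonnegative rank-three matrix with six rows, i.e. the generalized slack matrix of a hexagon inside a
polygon, of psd rank `≤ 4` by Prop. 3.6 and Thm. 3.4; concatenation adds psd ranks (block-diagonal
factors). Here the hexagon is made explicit as six consecutive vertices of the POLAR polygon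
(`polarVertex`, convex by `isConvexPolygon_polarVertex`), Prop. 3.6 is
`IsConvexPolygon.hasPsdFactorization_of_valid`, Thm. 3.4 is
`IsConvexPolygon.hasPsdFactorization_four_hexagon`, and the concatenation is FGPRT Thm. 2.9 (iii)
`HasPsdFactorization.add`. (The general matrix statement `GouveiaRobinsonThomas2015_thm37` — six
arbitrary points, not necessarily in convex position — stays a typed fact: it needs the facial
structure of the convex hull of six arbitrary planar points.) [cite: GouveiaRobinsonThomas2015, Thm. 3.7 (p07)] -/
theorem IsConvexPolygon.hasPsdFactorization_four_mul_ceil_div_six {x : Fin m → (Fin 2 → ℝ)}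
    (hx : IsConvexPolygon x) (hm : 3 ≤ m) :
    HasPsdFactorization (polygonSlack x) (4 * ((m + 5) / 6)) := by
  rcases Nat.lt_or_ge m 6 with h6 | h6
  · exact GouveiaRobinsonThomas2015_thm37_polygon_of_le_five x hm (by omega) hx
  · have h := hx.hasPsdFactorization_blocks_lt h6 ((m + 5) / 6)
    have hfun : (fun i (j : Fin m) => if j.val / 6 < (m + 5) / 6 then polygonSlack x i j else 0) =
        polygonSlack x := by
      funext i j
      have := j.isLt
      rw [if_pos (by omega)]
    rwa [hfun] at h

/-- **GRT Theorem 3.7, polygon clause, in the exact printed form** `rank_psd ≤ 4⌈v/6⌉`.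
[cite: GouveiaRobinsonThomas2015, Thm. 3.7 (p07)] -/
theorem GouveiaRobinsonThomas2015_thm37_polygon {x : Fin m → (Fin 2 → ℝ)} (hx : IsConvexPolygon x)
    (hm : 3 ≤ m) : HasPsdFactorization (polygonSlack x) (4 * ⌈(m : ℚ) / 6⌉₊) := by
  have h : ⌈(m : ℚ) / 6⌉₊ = (m + 5) / 6 := by
    set n := (m + 5) / 6 with hn
    have hn1 : 1 ≤ n := by omega
    have hup : n * 6 ≤ m + 5 := by omega
    have hlo : m ≤ n * 6 := by omega
    rw [Nat.ceil_eq_iff (by omega : n ≠ 0)]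
    constructor
    · rw [Nat.cast_sub hn1, Nat.cast_one, lt_div_iff₀ (by norm_num : (0:ℚ) < 6)]
      have : (n : ℚ) * 6 ≤ (m : ℚ) + 5 := by exact_mod_cast hup
      linarith
    · rw [div_le_iff₀ (by norm_num : (0:ℚ) < 6)]
      exact_mod_cast hlo
  rw [h]
  exact hx.hasPsdFactorization_four_mul_ceil_div_six hm

/-- **Psd rank of polygons, summary** (p07): every convex `m`-gon, `m ≥ 6`, has a psd
factorization of size `min(m − 2, 4⌈m/6⌉)` and none of size `3`. [cite: GouveiaRobinsonThomas2015, §3 (p07)] -/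
theorem IsConvexPolygon.psdRank_bounds {x : Fin m → (Fin 2 → ℝ)} (hx : IsConvexPolygon x) (hm : 6 ≤ m) :
    HasPsdFactorization (polygonSlack x) (min (m - 2) (4 * ((m + 5) / 6))) ∧
      ¬ HasPsdFactorization (polygonSlack x) 3 := by
  refine ⟨?_, hx.not_hasPsdFactorization_three (by omega)⟩
  rcases le_total (m - 2) (4 * ((m + 5) / 6)) with h | h
  · rw [min_eq_left h]; exact hx.hasPsdFactorization_sub_two hm
  · rw [min_eq_right h]; exact hx.hasPsdFactorization_four_mul_ceil_div_six (by omega)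

/-- Theorem 3.7's polygon clause as a statement on psd LIFTS (FGPRT Thm. 3.3,
`IsConvexPolygon.hasPsdLift_iff`): every convex `m`-gon is a linear image of an affine slice of
`S^{4⌈m/6⌉}_+`. [cite: GouveiaRobinsonThomas2015, Thm. 3.7 (p07)] -/
theorem GouveiaRobinsonThomas2015_thm37_polygon_lift {x : Fin m → (Fin 2 → ℝ)}
    (hx : IsConvexPolygon x) (hm : 3 ≤ m) :
    HasPsdLift (convexHull ℝ (Set.range x)) (4 * ((m + 5) / 6)) :=
  (hx.hasPsdLift_iff hm (by omega)).mpr (hx.hasPsdFactorization_four_mul_ceil_div_six hm)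

end PolygonClause

/-! ### Polarity preserves psd rank (polygons); the p07 sentence on `6 × q` matrices -/

section Polarity

variable {m : ℕ} [NeZero m]

/-- **Psd rank is preserved under polarity, for polygons** (GRT 2013 p12: "psd rank is preserved
under polarity", after [GPT2011]): the slack matrix of the polar polygon is a positive row/column
rescaling of the transposed, cyclically re-indexed slack matrix (`c_j c_{j+1} c_k S^w_{kj} =
S_{j+2,j} S_{j+1,k}`), so it has a psd factorization of size `r` iff the original does.
[cite: GouveiaRobinsonThomas2013, §4 (p12, "psd rank is preserved under polarity")] -/
theorem IsConvexPolygon.hasPsdFactorization_polarVertex_iff {x : Fin m → (Fin 2 → ℝ)}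
    (hx : IsConvexPolygon x) (hm : 3 ≤ m) {r : ℕ} :
    HasPsdFactorization (polygonSlack (polarVertex x)) r ↔ HasPsdFactorization (polygonSlack x) r := by
  have hc : ∀ j, 0 < slackCenter x j := fun j => hx.slackCenter_pos hm j
  have hc' : ∀ j, slackCenter x j ≠ 0 := fun j => (hc j).ne'
  have hS2 : ∀ j : Fin m, 0 < polygonSlack x (j + 1 + 1) j := by
    intro j
    refine hx _ _ ?_ ?_
    · intro h'
      have h2 : (1 : Fin m) + 1 = 0 := by
        have := congrArg (fun t => t - j) h'
        simpa [add_assoc, add_sub_cancel_left] using this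
      have := congrArg Fin.val h2
      rw [Fin.val_add, Fin.val_one', Fin.val_zero, Nat.mod_eq_of_lt (show 1 < m by omega),
        Nat.mod_eq_of_lt (show 1 + 1 < m by omega)] at this
      omega
    · intro h'
      have h2 : (1 : Fin m) = 0 := by simpa using congrArg (fun t => t - (j + 1)) h'
      have := congrArg Fin.val h2
      rw [Fin.val_one', Fin.val_zero, Nat.mod_eq_of_lt (show 1 < m by omega)] at this
      omega
  -- `S^w = D₁ T D₂` with `T(k,j) = S_{j+1,k}`
  have hT : (polygonSlack (polarVertex x) : Fin m → Fin m → ℝ) =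
      fun k j => (slackCenter x k)⁻¹ * polygonSlack x (j + 1) k *
        (polygonSlack x (j + 1 + 1) j / (slackCenter x j * slackCenter x (j + 1))) := by
    funext k j
    have h := slackCenter_mul_polygonSlack_polarVertex hc' k j
    have hk := hc' k; have hj := hc' j; have hj1 := hc' (j + 1)
    field_simp
    linear_combination h
  have hTiff : HasPsdFactorization (fun k j => polygonSlack x (j + 1) k) r ↔
      HasPsdFactorization (polygonSlack x) r := by
    constructor
    · intro h
      have h' := (h.submatrix id (fun j : Fin m => j - 1)).transpose
      have hfun : (fun (j : Fin m) (k : Fin m) => polygonSlack x (j - 1 + 1) (id k)) = polygonSlack x := by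
        funext j k; rw [sub_add_cancel, id]
      rwa [show (fun j k => (fun k j => polygonSlack x (j + 1) k) (id k) (j - 1)) =
        fun j k => polygonSlack x (j - 1 + 1) (id k) from rfl, hfun] at h'
    · intro h
      exact (h.submatrix (fun j : Fin m => j + 1) id).transpose
  rw [hT, hasPsdFactorization_rescale_iff (M := fun k j => polygonSlack x (j + 1) k)
    (fun k => inv_pos.mpr (hc k)) (fun j => div_pos (hS2 j) (mul_pos (hc j) (hc (j + 1)))), hTiff]

/-- **p07, verbatim**: "In particular, a `6 × q` nonnegative matrix of rank three is the generalized
slack matrix of a hexagon inside a `q`-gon and so has psd rank at most four" — here for the six row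
points in convex position (more generally a convex `m`-gon with `3 ≤ m ≤ 6`): its generalized slack
matrix against ANY family of valid affine functionals `L_t(y) = g_t·y + c_t ≥ 0` has an
`S^4_+`-factorization (Prop. 3.6 at matrix level + Thm. 3.4 / Ex. 3.2 / GRT 2013 Thm. 4.7). The case of
six arbitrary points (the typed fact `GouveiaRobinsonThomas2015_thm37`) additionally needs the facial
structure of their convex hull (`PlanarConvexHullPolygon.lean`) and is proved in
`RankThreePsdRank.lean` (`hasPsdFactorization_of_valid_points`). [cite: GouveiaRobinsonThomas2015, §3 (p07)] -/
theorem IsConvexPolygon.hasPsdFactorization_four_of_valid {x : Fin m → (Fin 2 → ℝ)}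
    (hx : IsConvexPolygon x) (hm : 3 ≤ m) (hm6 : m ≤ 6) {ι : Type*} (g : ι → Fin 2 → ℝ) (c : ι → ℝ)
    (hL : ∀ t j, 0 ≤ g t ⬝ᵥ x j + c t) : HasPsdFactorization (fun j t => g t ⬝ᵥ x j + c t) 4 := by
  have h := hx.hasPsdFactorization_four_mul_ceil_div_six hm
  have h4 : 4 * ((m + 5) / 6) = 4 := by omega
  rw [h4] at h
  exact hx.hasPsdFactorization_of_valid hm h g c hL

end Polarity


end Literature.Combinatorics.Optimization
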